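import Literature.NumberTheory.LFunctions.WeilGroundStateRealZeros
import Literature.NumberTheory.LFunctions.WeilExplicitRightEdge
import Mathlib.Analysis.ODE.Gronwall
import Mathlib.MeasureTheory.Covering.DensityTheorem
import Mathlib.MeasureTheory.Measure.Lebesgue.EqHaar
import Mathlib.MeasureTheory.Integral.MeanInequalities
import HarnessLib

/-!
# Real zeros of the transform of the ground state of the truncated Weil form: proof

Discharge of the named fact `Connes2026_weilGroundState_zeros_re_eq_half` of
`Literature/NumberTheory/LFunctions/WeilGroundStateRealZeros.lean`:

  for every window `a`, if the bottom `ε(a)` of Weil's quadratic form `Q(g) = W(g ⋆ g̃)` on the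
  test functions supported in `[-a, a]` is simple, isolated and even in the variational sense
  `WeilWindowSimpleEven a`, then for every ground state `u` (`IsWeilGroundState a u`: an
  `L²`-limit of an `L²`-normalised minimising sequence of window test functions) every zero `s`
  of `û(s) = weilMellin u s = ∫ u(t) e^{(s-1/2)t} dt` has `Re s = 1/2`

(`theorem Connes2026_weilGroundState_zeros_re_eq_half_holds`, at the end of the file). This is
A. Connes, *The Riemann Hypothesis: Past, Present and a Letter Through Time* (2026), §5–§6.1, whose
proof in print is A. Connes, W. D. van Suijlekom, *Quadratic Forms, Real Zeros and Echoes of the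
Spectral Action*, Comm. Math. Phys. 406 (2025) = arXiv:2511.23257, Theorem 6.1 (= Thm. 1.2).

## The printed proof and the proof given here

Connes–van Suijlekom prove Thm. 6.1 (p. 11) in five steps: the trigonometric polynomials are a
core of the lower-bounded self-adjoint operator `A` of the form; by min–max and the spectral gap,
the bottom eigenvector `ξ_N` of the finite section `Q_N` (basis `U_{-N}, …, U_N`) is simple and
`ξ_N → ξ` in `L²`; the finite sections have the special shape of Prop. 4.1,
`q_{ij} = (b_i - b_j)/(i - j)` off the diagonal, i.e. the commutation relation (5.2)
`D Q − Q D = |β⟩⟨η| − |η⟩⟨β|` with the diagonal "frequency" operator `D`; the finite-dimensional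
Thm. 5.6 (all roots of `Σ ξ_k Π_{j ≠ k}(j − s)` are real, proved through the `Q`-self-adjoint
rank-one perturbation `D' = D − |Dξ⟩⟨η|` of Lemma 5.2 and the determinant formula (5.5));
finally Hurwitz's theorem.

Mathlib (at the tree's pin) has neither closed quadratic forms / unbounded self-adjoint
operators with min–max, nor Hurwitz's theorem, so the finite-section architecture is not
reproduced. Instead this file proves the theorem by the CONTINUUM FORM OF THE SAME MECHANISM,
which needs no finite sections and no limit theorem for zeros:

* (§D, the analogue of Lemma 5.1 (5.2) and Lemma 5.2.) `Q(g) = W(g ⋆ g̃)` sees `g` only through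
  the kernel `g ⋆ g̃`, and `d/dt` is skew for this translation-invariant pairing:
  `v' ⋆ ṽ = (v ⋆ ṽ)' = −v ⋆ (v')̃`. Hence for every test function `v` and `c ∈ ℂ` the kernels
  of `v' − c v` and of `v' + c̄ v` COINCIDE (`weilConv_weilReflect_deriv_sub_eq`), so these two
  functions have the same energy `Q` and the same `L²` norm. (On functions vanishing at the ends
  of the window the boundary term `|β⟩⟨η| − |η⟩⟨β|` of (5.2) is absent.)
* (§C, the analogue of the factorisation `P(z) = (z − z₀) R(z)` behind Cor. 1.1 / (5.5).) A zero
  `û(s₀) = 0`, `w = s₀ − 1/2`, lets one write window test functions `g` with `ĝ(s₀) = 0` as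
  `g = v' + w v` with the window test function `v(t) = e^{-wt} ∫_{-a}^t g e^{wτ}`
  (`exists_primitive`); and the minimising sequence `gₘ → u` can be corrected by multiples,
  tending to `0`, of a fixed bump so that `ĝₘ(s₀) = 0` (`exists_modifiedSeq`).
* (§B, the analogue of "the restriction of `Q` to `ξ^⊥` is `≥ λ + δ`", p. 11.) From
  `WeilWindowSimpleEven a` — a gap `δ` on odd test functions and on even test functions
  orthogonal to an ARBITRARY witness `φ` (junk values of `∫ conj φ · g` included) — and the
  existence of the ground state `u` we derive, by two-dimensional perturbation along the
  minimising sequence and Cauchy–Schwarz for the non-negative form `q = Re Q − ε(a)‖·‖²`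
  (§A), the genuine gap inequality `δ (‖g‖₂² − |⟨g, u⟩|²) ≤ q(g)` for all window test functions
  (`gap_inequality`). No operator is posited.
* (§E, replacing Thm. 5.6 + Hurwitz.) If `Re s₀ ≠ 1/2`, i.e. `x = Re w ≠ 0`, the test functions
  `kₘ = vₘ' − w̄ vₘ = gₘ − 2x vₘ` have the same vanishing energies as `gₘ`, so by the gap their
  distance to `ℂu` tends to `0`; in the `L²`-limit `u − 2x V ∈ ℂ u` where
  `V = 1_{[-a,a]} e^{-wt} ∫_{-a}^t u e^{wτ}`, i.e. `V = κ u` a.e. Then the continuous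
  `F(t) = ∫_{-a}^t u e^{wτ}` vanishes identically (for `κ ≠ 0` it solves `F = κ⁻¹ ∫ F`,
  Gronwall; for `κ = 0` directly, by continuity), so all interval integrals of `u e^{wτ}` vanish
  and `u = 0` a.e. by Lebesgue differentiation — contradicting `‖u‖₂ = 1`. (This is the
  continuum version of the argument "`T` positive with one-dimensional kernel and `a ∈ ker T`
  force `|z₀| = 1`": the reflected factorisation has the same energy, and simplicity of the
  bottom leaves no room for it.)

Remark: as in the finite-dimensional computation, only the simplicity/gap of the bottom is used;
the evenness built into `WeilWindowSimpleEven` is not needed by the argument (it is of course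
part of the hypothesis as printed).

## Layout

* §0 — algebra of `W`, `⋆`, `̃` on test functions (reflection invariance of `W`, additivity,
  polarisation `Q(g + h) = Q(g) + Q(h) + W(g ⋆ h̃) + W(h ⋆ g̃)`, parity splitting). These are
  PRIVATE copies of the API of `Literature/NumberTheory/LFunctions/WeilWindowSimpleEven.lean`,
  which cannot be imported together with `WeilGroundStateRealZeros.lean` (both files declare
  `Literature.NumberTheory.LFunctions.WeilWindowSimpleEven`); likewise the two Cauchy–Schwarz
  lemmas of §B are private copies from `Literature/MathematicalPhysics/QuantumLattice/OSPolyCluster.lean`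
  (not imported to keep the import cone of this number-theory file small).
* §A — the shifted form `q` on window test functions: `q ≥ 0`, expansion along real lines,
  Cauchy–Schwarz `|q(f+h) − q(f) − q(h)| ≤ 2√q(f)√q(h)`.
* §B — `L²` pairings (Cauchy–Schwarz, Pythagoras), the clause of `WeilWindowSimpleEven`
  un-normalised and made junk-safe, the perturbation step `gap_step`, `gap_inequality`.
* §C — bump with `ĥ(s₀) ≠ 0`, primitives, the corrected minimising sequence, `L²` limits.
* §D — the translation identity.
* §E — Lebesgue differentiation and Gronwall lemmas, `weilMellin_ne_zero_of_re_ne_half`, and the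
  discharge `Connes2026_weilGroundState_zeros_re_eq_half_holds`.

All helper statements live in the sub-namespace `Literature.NumberTheory.LFunctions.ConnesVanSuijlekom`
(named after the paper whose mechanism they formalise); only the discharge theorem is declared in
`Literature.NumberTheory.LFunctions`. No definitions, no named facts are introduced.

## References

* [ConnesSuijlekom2025] A. Connes, W. D. van Suijlekom, *Quadratic Forms, Real Zeros and Echoes of
  the Spectral Action*, Comm. Math. Phys. 406 (2025), arXiv:2511.23257: Cor. 1.1, Prop. 4.1,
  Lemma 5.1 (5.2), Lemma 5.2, Thm. 5.6, Thm. 6.1 (proof p. 11).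
* [Connes2026Letter] A. Connes, *The Riemann Hypothesis: Past, Present and a Letter Through Time*
  (2026), arXiv:2602.04022, §5 (p. 20), §6.1.
* [Bombieri2000Weil] E. Bombieri, Rend. Mat. Acc. Lincei (9) 11 (2000), §4 (Problem 2, Thm. 3).
* [ConnesConsani2023] A. Connes, C. Consani, Enseign. Math. 69 (2023), §2.1.3 (parity splitting).
-/

noncomputable section

open Complex Filter Set MeasureTheory
open scoped Real Topology Convolution ComplexConjugate ContDiff

namespace Literature.NumberTheory.LFunctions

namespace ConnesVanSuijlekom

/-! ## §0. Algebra of `W`, `⋆`, `̃` on test functions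

Private verbatim copies of the API of `Literature/NumberTheory/LFunctions/WeilWindowSimpleEven.lean`.
That file cannot be imported next to `WeilGroundStateRealZeros.lean`: both declare
`Literature.NumberTheory.LFunctions.WeilWindowSimpleEven`. -/

section Reflection

variable (g h k : ℝ → ℂ)

/-- Reflection commutes with convolution: `(g(-·)) ⋆ (h(-·)) = (g ⋆ h)(-·)` (substitute `u ↦ -u`;
no hypotheses). Copy of `weilConv_comp_neg`. [folklore] -/
private theorem weilConv_comp_neg :
    weilConv (fun t ↦ g (-t)) (fun t ↦ h (-t)) = fun t ↦ weilConv g h (-t) := by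
  funext t
  rw [weilConv_apply, weilConv_apply,
    ← integral_neg_eq_self (fun u : ℝ ↦ g u * h (-t - u)) volume]
  congr 1 with u
  rw [show -(t - u) = -t - -u by ring]

/-- Reflection commutes with the involution: `(g(-·))̃ = g̃(-·)` (definitional). [folklore] -/
private theorem weilReflect_comp_neg : weilReflect (fun t ↦ g (-t)) = fun t ↦ weilReflect g (-t) := rfl

/-- The polar term is reflection invariant (`(k(-·))^(s) = k̂(1 - s)`). [folklore] -/
private theorem weilPolarTerm_comp_neg : weilPolarTerm (fun t ↦ k (-t)) = weilPolarTerm k := by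
  rw [weilPolarTerm, weilPolarTerm, weilMellin_comp_neg, weilMellin_comp_neg, sub_zero, sub_self,
    add_comm]

/-- The prime term is reflection invariant (it only involves `k(log n) + k(-log n)`). [folklore] -/
private theorem weilPrimeTerm_comp_neg : weilPrimeTerm (fun t ↦ k (-t)) = weilPrimeTerm k := by
  unfold weilPrimeTerm
  refine tsum_congr fun n ↦ ?_
  dsimp only
  rw [neg_neg, add_comm (k (-Real.log n))]

/-- The archimedean integral is reflection invariant: `(k(-·))^(1/2 + it) = k̂(1/2 - it)`, and
`Re ψ(1/4 + it/2)` is even in `t` since `ψ(s̄) = conj ψ(s)`; substitute `t ↦ -t`. [folklore] -/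
private theorem weilArchIntegral_comp_neg : weilArchIntegral (fun t ↦ k (-t)) = weilArchIntegral k := by
  unfold weilArchIntegral
  rw [← integral_neg_eq_self (fun t : ℝ ↦ weilMellin k (1 / 2 + t * I) *
    ((Complex.digamma (1 / 4 + t / 2 * I)).re : ℂ)) volume]
  congr 1 with t
  rw [weilMellin_comp_neg, quarter_add_neg_mul_I, digamma_conj, Complex.conj_re]
  congr 2
  push_cast
  ring

/-- The archimedean term is reflection invariant. [folklore] -/
private theorem weilArchTerm_comp_neg : weilArchTerm (fun t ↦ k (-t)) = weilArchTerm k := by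
  rw [weilArchTerm, weilArchTerm, weilArchIntegral_comp_neg, neg_zero]

/-- **Parity invariance of the Weil functional**: `W(k(-·)) = W(k)` for every `k : ℝ → ℂ`
(Weil's distribution is even; Connes–van Suijlekom 2025 §4, the even distribution `D̃`).
Hypothesis-free. [folklore] -/
private theorem weilFunctional_comp_neg : weilFunctional (fun t ↦ k (-t)) = weilFunctional k := by
  rw [weilFunctional, weilFunctional, weilPolarTerm_comp_neg, weilPrimeTerm_comp_neg,
    weilArchTerm_comp_neg]

end Reflection

section Linear

variable {g g₁ g₂ h h₁ h₂ k k₁ k₂ : ℝ → ℂ}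

/-- `g ⋆ (c h) = c (g ⋆ h)` (no hypotheses). [folklore] -/
private theorem weilConv_const_mul_right (c : ℂ) (g h : ℝ → ℂ) :
    weilConv g (fun t ↦ c * h t) = fun t ↦ c * weilConv g h t := by
  funext t
  rw [weilConv_apply, weilConv_apply, ← integral_const_mul]
  congr 1 with u
  ring

/-- `(c g) ⋆ h = c (g ⋆ h)` (no hypotheses). [folklore] -/
private theorem weilConv_const_mul_left (c : ℂ) (g h : ℝ → ℂ) :
    weilConv (fun t ↦ c * g t) h = fun t ↦ c * weilConv g h t := by
  funext t
  rw [weilConv_apply, weilConv_apply, ← integral_const_mul]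
  congr 1 with u
  ring

/-- `(c g)̃ = conj c · g̃`. [folklore] -/
private theorem weilReflect_const_mul (c : ℂ) (g : ℝ → ℂ) :
    weilReflect (fun t ↦ c * g t) = fun t ↦ conj c * weilReflect g t := by
  funext t
  simp [weilReflect]

/-- `(g + h)̃ = g̃ + h̃`. [folklore] -/
private theorem weilReflect_add (g h : ℝ → ℂ) : weilReflect (g + h) = weilReflect g + weilReflect h := by
  funext t
  simp [weilReflect]

/-- `(g₁ + g₂) ⋆ h = g₁ ⋆ h + g₂ ⋆ h` for test functions. [folklore] -/
private theorem weilConv_add_left (hg₁ : IsWeilTest g₁) (hg₂ : IsWeilTest g₂) (hh : IsWeilTest h) :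
    weilConv (g₁ + g₂) h = weilConv g₁ h + weilConv g₂ h :=
  ConvolutionExists.add_distrib
    (hh.2.convolutionExists_right _ hg₁.1.continuous.locallyIntegrable hh.1.continuous)
    (hh.2.convolutionExists_right _ hg₂.1.continuous.locallyIntegrable hh.1.continuous)

/-- `g ⋆ (h₁ + h₂) = g ⋆ h₁ + g ⋆ h₂` for test functions. [folklore] -/
private theorem weilConv_add_right (hg : IsWeilTest g) (hh₁ : IsWeilTest h₁) (hh₂ : IsWeilTest h₂) :
    weilConv g (h₁ + h₂) = weilConv g h₁ + weilConv g h₂ :=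
  ConvolutionExists.distrib_add
    (hh₁.2.convolutionExists_right _ hg.1.continuous.locallyIntegrable hh₁.1.continuous)
    (hh₂.2.convolutionExists_right _ hg.1.continuous.locallyIntegrable hh₂.1.continuous)

/-- The archimedean integrand `t ↦ k̂(1/2 + it) · Re ψ(1/4 + it/2)` of `weilArchIntegral k` is
integrable for every test function `k` (`|k̂| ≤ D/(1 + t²)²` on the critical line and
`|ψ(1/4 + it/2)| ≤ C + log(1 + |t|)`). [folklore] -/
private theorem integrable_weilArchIntegrand (hk : IsWeilTest k) :
    Integrable fun t : ℝ ↦ weilMellin k (1 / 2 + t * I) *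
      ((Complex.digamma (1 / 4 + t / 2 * I)).re : ℂ) := by
  obtain ⟨C, hC⟩ :=
    Literature.Analysis.SpecialFunctions.Complex.exists_norm_digamma_vertical_le
      (a := 1 / 4) (by norm_num)
  set F : ℝ → ℂ := fun t ↦ ((Complex.digamma (1 / 4 + t / 2 * I)).re : ℂ) with hF
  have hw : ∀ t : ℝ, (1 / 4 : ℂ) + (t : ℂ) / 2 * I = ((1 / 4 : ℝ) : ℂ) + ((t / 2 : ℝ) : ℂ) * I := by
    intro t
    push_cast
    ring
  have hFc : Continuous F := by
    refine continuous_ofReal.comp (Complex.continuous_re.comp ?_)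
    refine Literature.Analysis.SpecialFunctions.Complex.continuousOn_digamma.comp_continuous
      (by fun_prop) fun t ↦ ?_
    rw [hw t]
    simp
  have hFb : ∀ t : ℝ, ‖F t‖ ≤ C + Real.log (1 + |t|) := by
    intro t
    have h1 : ‖F t‖ ≤ ‖Complex.digamma (1 / 4 + t / 2 * I)‖ := by
      simp only [hF, Complex.norm_real, Real.norm_eq_abs]
      exact Complex.abs_re_le_norm _
    have h2 := hC (t / 2)
    rw [← hw t] at h2
    have h3 : Real.log (1 + |t / 2|) ≤ Real.log (1 + |t|) := by
      refine Real.log_le_log (by positivity) ?_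
      rw [abs_div, abs_two]
      linarith [abs_nonneg t]
    linarith
  have hI := integrable_mul_weilMellin_vertical_of_norm_le_log hk (1 / 2) hFc hFb
  refine hI.congr (Eventually.of_forall fun t ↦ ?_)
  simp only [hF]
  rw [mul_comm]
  push_cast
  ring_nf

/-- Additivity of the archimedean integral on test kernels. [folklore] -/
private theorem weilArchIntegral_add (hk₁ : IsWeilTest k₁) (hk₂ : IsWeilTest k₂) :
    weilArchIntegral (k₁ + k₂) = weilArchIntegral k₁ + weilArchIntegral k₂ := by
  unfold weilArchIntegral
  rw [← integral_add (integrable_weilArchIntegrand hk₁) (integrable_weilArchIntegrand hk₂)]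
  congr 1 with t
  rw [weilMellin_add hk₁.1.continuous hk₁.2 hk₂.1.continuous hk₂.2]
  ring

/-- **Additivity of the Weil functional on test kernels**: `W(k₁ + k₂) = W(k₁) + W(k₂)`. [folklore] -/
private theorem weilFunctional_add (hk₁ : IsWeilTest k₁) (hk₂ : IsWeilTest k₂) :
    weilFunctional (k₁ + k₂) = weilFunctional k₁ + weilFunctional k₂ := by
  have hM := weilMellin_add hk₁.1.continuous hk₁.2 hk₂.1.continuous hk₂.2
  have hP : weilPolarTerm (k₁ + k₂) = weilPolarTerm k₁ + weilPolarTerm k₂ := by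
    simp only [weilPolarTerm, hM]
    ring
  have hPr : weilPrimeTerm (k₁ + k₂) = weilPrimeTerm k₁ + weilPrimeTerm k₂ := by
    unfold weilPrimeTerm
    rw [← (summable_weilPrimeTerm hk₁.2).tsum_add (summable_weilPrimeTerm hk₂.2)]
    refine tsum_congr fun n ↦ ?_
    simp only [Pi.add_apply]
    ring
  have hA : weilArchTerm (k₁ + k₂) = weilArchTerm k₁ + weilArchTerm k₂ := by
    simp only [weilArchTerm, weilArchIntegral_add hk₁ hk₂, Pi.add_apply]
    ring
  simp only [weilFunctional, hP, hPr, hA]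
  ring

end Linear

section Parity

variable {e o g h : ℝ → ℂ}

/-- For `e` even and `o` odd the cross kernel `e ⋆ õ` is odd, hence `W(e ⋆ õ) = 0`.
[cite: ConnesConsani2023, §2.1.3 Lemma 2.5 (iii)] -/
private theorem weilFunctional_weilConv_weilReflect_eq_zero_of_even_odd
    (he : ∀ t, e (-t) = e t) (ho : ∀ t, o (-t) = -o t) :
    weilFunctional (weilConv e (weilReflect o)) = 0 := by
  have h1 : (fun t ↦ e (-t)) = e := funext he
  have h2 : (fun t ↦ o (-t)) = fun t ↦ (-1 : ℂ) * o t := funext fun t ↦ by rw [ho, neg_one_mul]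
  have hodd : (fun t ↦ weilConv e (weilReflect o) (-t)) =
      fun t ↦ (-1 : ℂ) * weilConv e (weilReflect o) t := by
    rw [← weilConv_comp_neg, ← weilReflect_comp_neg, h1, h2, weilReflect_const_mul, map_neg, map_one,
      weilConv_const_mul_right]
  have h := weilFunctional_comp_neg (weilConv e (weilReflect o))
  rw [hodd, weilFunctional_const_mul] at h
  linear_combination (-1 / 2 : ℂ) * h

/-- Symmetric companion: for `o` odd and `e` even, `W(o ⋆ ẽ) = 0`.
[cite: ConnesConsani2023, §2.1.3 Lemma 2.5 (iii)] -/
private theorem weilFunctional_weilConv_weilReflect_eq_zero_of_odd_even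
    (ho : ∀ t, o (-t) = -o t) (he : ∀ t, e (-t) = e t) :
    weilFunctional (weilConv o (weilReflect e)) = 0 := by
  have h1 : (fun t ↦ e (-t)) = e := funext he
  have h2 : (fun t ↦ o (-t)) = fun t ↦ (-1 : ℂ) * o t := funext fun t ↦ by rw [ho, neg_one_mul]
  have hodd : (fun t ↦ weilConv o (weilReflect e) (-t)) =
      fun t ↦ (-1 : ℂ) * weilConv o (weilReflect e) t := by
    rw [← weilConv_comp_neg, ← weilReflect_comp_neg, h1, h2, weilConv_const_mul_left]
  have h := weilFunctional_comp_neg (weilConv o (weilReflect e))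
  rw [hodd, weilFunctional_const_mul] at h
  linear_combination (-1 / 2 : ℂ) * h

/-- **Polarisation of `Q` over a sum** of test functions:
`Q(g + h) = Q(g) + Q(h) + (W(g ⋆ h̃) + W(h ⋆ g̃))`.
[cite: Bombieri2000Weil, §3 (the hermitian form attached to T)] -/
private theorem weilQuadratic_add (hg : IsWeilTest g) (hh : IsWeilTest h) :
    weilQuadratic (g + h) = weilQuadratic g + weilQuadratic h +
      (weilFunctional (weilConv g (weilReflect h)) + weilFunctional (weilConv h (weilReflect g))) := by
  have hg' := hg.weilReflect
  have hh' := hh.weilReflect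
  unfold weilQuadratic
  rw [weilReflect_add, weilConv_add_left hg hh (hg'.add hh'), weilConv_add_right hg hg' hh',
    weilConv_add_right hh hg' hh',
    weilFunctional_add ((hg.weilConv hg').add (hg.weilConv hh')) ((hh.weilConv hg').add (hh.weilConv hh')),
    weilFunctional_add (hg.weilConv hg') (hg.weilConv hh'),
    weilFunctional_add (hh.weilConv hg') (hh.weilConv hh')]
  ring

/-- **`Q` is parity-block-diagonal**: for test functions `e` even and `o` odd,
`Q(e + o) = Q(e) + Q(o)`. [cite: ConnesConsani2023, §2.1.3 eq. QW_λ = QW_λ⁺ ⊕ QW_λ⁻] -/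
private theorem weilQuadratic_add_of_even_odd (he : IsWeilTest e) (ho : IsWeilTest o)
    (hev : ∀ t, e (-t) = e t) (hodd : ∀ t, o (-t) = -o t) :
    weilQuadratic (e + o) = weilQuadratic e + weilQuadratic o := by
  rw [weilQuadratic_add he ho, weilFunctional_weilConv_weilReflect_eq_zero_of_even_odd hev hodd,
    weilFunctional_weilConv_weilReflect_eq_zero_of_odd_even hodd hev, add_zero, add_zero]

/-- The even part `½(g + g(-·))` of a test function is a test function. [folklore] -/
private theorem isWeilTest_evenPart (hg : IsWeilTest g) : IsWeilTest fun t ↦ (g t + g (-t)) / 2 := by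
  have h := (hg.add hg.comp_neg).const_mul (1 / 2)
  convert h using 1
  funext t
  simp only [Pi.add_apply]
  ring

/-- The odd part `½(g - g(-·))` of a test function is a test function. [folklore] -/
private theorem isWeilTest_oddPart (hg : IsWeilTest g) : IsWeilTest fun t ↦ (g t - g (-t)) / 2 := by
  have h := (hg.add (hg.comp_neg.const_mul (-1))).const_mul (1 / 2)
  convert h using 1
  funext t
  simp only [Pi.add_apply]
  ring

/-- **Parity splitting of `Q`**: for every test function `g`,
`Q(g) = Q(½(g + g(-·))) + Q(½(g - g(-·)))`. [cite: ConnesConsani2023, §2.1.3 eq. QW_λ = QW_λ⁺ ⊕ QW_λ⁻] -/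
private theorem weilQuadratic_eq_evenPart_add_oddPart (hg : IsWeilTest g) :
    weilQuadratic g =
      weilQuadratic (fun t ↦ (g t + g (-t)) / 2) + weilQuadratic (fun t ↦ (g t - g (-t)) / 2) := by
  have hsum : g = (fun t ↦ (g t + g (-t)) / 2) + fun t ↦ (g t - g (-t)) / 2 := by
    funext t
    simp only [Pi.add_apply]
    ring
  conv_lhs => rw [hsum]
  refine weilQuadratic_add_of_even_odd (isWeilTest_evenPart hg) (isWeilTest_oddPart hg) (fun t ↦ ?_) (fun t ↦ ?_)
  · simp only [neg_neg]
    ring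
  · simp only [neg_neg]
    ring

end Parity


/-! ## §A. The shifted form `q(f) = Re Q(f) − ε(a)‖f‖²` on window test functions:
positivity, expansion along lines, Cauchy–Schwarz -/

section Form

variable {a : ℝ} {f g h : ℝ → ℂ}

/-- A test function is in `L²`. [folklore] -/
theorem isWeilTest_memLp (hf : IsWeilTest f) : MemLp f 2 :=
  hf.1.continuous.memLp_of_hasCompactSupport hf.2

/-- `t ↦ f t * conj (h t)` is integrable for test functions. [folklore] -/
theorem integrable_mul_conj (hf : IsWeilTest f) (hh : IsWeilTest h) :
    Integrable fun t : ℝ ↦ f t * conj (h t) :=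
  ((hf.1.continuous.mul (Complex.continuous_conj.comp hh.1.continuous)).integrable_of_hasCompactSupport
    hf.2.mul_right)

/-- **`q ≥ 0` on the window**: for a test function `f` supported in `[-a, a]`,
`ε(a) · ∫|f|² ≤ Re Q(f)` (definition of `ε(a)` as an infimum over the unit sphere, homogeneity
`Q(c f) = |c|² Q(f)`, and `Q(0) = 0`). [cite: Bombieri2000Weil, §4 Problem 2] -/
theorem weilGroundEnergy_mul_le_re (hf : IsWeilTest f) (hsupp : tsupport f ⊆ Icc (-a) a) :
    weilGroundEnergy a * ∫ t, ‖f t‖ ^ 2 ≤ (weilQuadratic f).re := by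
  have hN2nn : 0 ≤ ∫ t : ℝ, ‖f t‖ ^ 2 := integral_nonneg fun _ ↦ by positivity
  rcases hN2nn.eq_or_lt with hz | hpos
  · have hf0 : f = 0 := hf.eq_zero_of_integral_norm_sq_eq_zero hz.symm
    subst hf0
    rw [weilQuadratic_zero, Complex.zero_re, ← hz, mul_zero]
  · set N2 : ℝ := ∫ t : ℝ, ‖f t‖ ^ 2 with hN2
    set c : ℝ := (Real.sqrt N2)⁻¹ with hc
    have hcpos : 0 < c := inv_pos.2 (Real.sqrt_pos.2 hpos)
    have hg't : IsWeilTest fun t ↦ (c : ℂ) * f t := hf.const_mul c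
    have hsupp' : tsupport (fun t ↦ (c : ℂ) * f t) ⊆ Icc (-a) a :=
      tsupport_mul_subset_right.trans hsupp
    have hnorm' : ∫ t : ℝ, ‖(c : ℂ) * f t‖ ^ 2 = 1 := by
      simp only [norm_mul, mul_pow, Complex.norm_real, Real.norm_of_nonneg hcpos.le]
      rw [integral_const_mul, hc, inv_pow, Real.sq_sqrt hN2nn, inv_mul_cancel₀ hpos.ne']
    have hmem : (weilQuadratic fun t ↦ (c : ℂ) * f t).re ∈
        {x : ℝ | ∃ g : ℝ → ℂ, IsWeilTest g ∧ tsupport g ⊆ Icc (-a) a ∧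
          ∫ t : ℝ, ‖g t‖ ^ 2 = 1 ∧ x = (weilQuadratic g).re} :=
      ⟨fun t ↦ (c : ℂ) * f t, hg't, hsupp', hnorm', rfl⟩
    have hle : weilGroundEnergy a ≤ (weilQuadratic fun t ↦ (c : ℂ) * f t).re :=
      csInf_le (bddBelow_weilQuadratic_sphere_holds a) hmem
    have hQ' : (weilQuadratic fun t ↦ (c : ℂ) * f t).re = c * c * (weilQuadratic f).re := by
      rw [weilQuadratic_const_mul, Complex.normSq_ofReal, Complex.re_ofReal_mul]
    have hcc : c * c * N2 = 1 := by
      rw [hc, ← mul_inv, Real.mul_self_sqrt hN2nn, inv_mul_cancel₀ hpos.ne']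
    have h1 : weilGroundEnergy a * (c * c * N2) ≤ c * c * (weilQuadratic f).re := by
      rw [hcc, mul_one, ← hQ']
      exact hle
    have h2 : c * c * (weilGroundEnergy a * N2) ≤ c * c * (weilQuadratic f).re := by linarith
    exact le_of_mul_le_mul_left h2 (mul_pos hcpos hcpos)

/-- **Expansion of `Re Q` along a real line**: for test functions `f, h` and real `t`,
`Re Q(f + t h) = Re Q(f) + t² Re Q(h) + t · Re(W(f ⋆ h̃) + W(h ⋆ f̃))`. [folklore] -/
theorem re_weilQuadratic_add_real_mul (hf : IsWeilTest f) (hh : IsWeilTest h) (t : ℝ) :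
    (weilQuadratic (f + fun x ↦ (t : ℂ) * h x)).re =
      (weilQuadratic f).re + t ^ 2 * (weilQuadratic h).re +
        t * (weilFunctional (weilConv f (weilReflect h)) +
          weilFunctional (weilConv h (weilReflect f))).re := by
  rw [weilQuadratic_add hf (hh.const_mul t), weilQuadratic_const_mul, weilReflect_const_mul,
    Complex.conj_ofReal, weilConv_const_mul_right, weilConv_const_mul_left, weilFunctional_const_mul,
    weilFunctional_const_mul, Complex.normSq_ofReal]
  simp only [Complex.add_re, Complex.re_ofReal_mul]
  ring

/-- **Expansion of `∫|·|²` along a real line**: `∫|f + t h|² = ∫|f|² + t²∫|h|² + 2t Re ∫ f h̄`. [folklore] -/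
theorem integral_norm_sq_add_real_mul (hf : IsWeilTest f) (hh : IsWeilTest h) (t : ℝ) :
    ∫ x, ‖(f + fun x ↦ (t : ℂ) * h x) x‖ ^ 2 =
      (∫ x, ‖f x‖ ^ 2) + t ^ 2 * (∫ x, ‖h x‖ ^ 2) + 2 * t * (∫ x, f x * conj (h x)).re := by
  have h1 : ∀ x, ‖(f + fun x ↦ (t : ℂ) * h x) x‖ ^ 2 =
      ‖f x‖ ^ 2 + t ^ 2 * ‖h x‖ ^ 2 + 2 * t * (f x * conj (h x)).re := by
    intro x
    simp only [Pi.add_apply]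
    rw [← Complex.normSq_eq_norm_sq, ← Complex.normSq_eq_norm_sq, ← Complex.normSq_eq_norm_sq,
      Complex.normSq_add, Complex.normSq_mul, Complex.normSq_ofReal, map_mul, Complex.conj_ofReal]
    have : (f x * (↑t * conj (h x))).re = t * (f x * conj (h x)).re := by
      rw [show f x * (↑t * conj (h x)) = (t : ℂ) * (f x * conj (h x)) by ring, Complex.re_ofReal_mul]
    rw [this]
    ring
  simp_rw [h1]
  have i1 : Integrable fun x ↦ ‖f x‖ ^ 2 := hf.integrable_norm_sq
  have i2 : Integrable fun x ↦ t ^ 2 * ‖h x‖ ^ 2 := hh.integrable_norm_sq.const_mul _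
  have i3 : Integrable fun x ↦ 2 * t * (f x * conj (h x)).re := by
    have := (integrable_mul_conj hf hh).re.const_mul (2 * t)
    simpa only [RCLike.re_to_complex] using this
  have i12 : Integrable fun x ↦ ‖f x‖ ^ 2 + t ^ 2 * ‖h x‖ ^ 2 := i1.add i2
  rw [integral_add i12 i3, integral_add i1 i2, integral_const_mul, integral_const_mul]
  congr 1
  have key := integral_re (integrable_mul_conj hf hh)
  simp only [RCLike.re_to_complex] at key
  rw [key]

/-- **Cauchy–Schwarz for the shifted form.** For test functions `f, h` on the window `[-a, a]`
put `q(φ) := Re Q(φ) − ε(a)∫|φ|²` (`≥ 0` there). Then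
`|q(f + h) − q(f) − q(h)| ≤ 2 √q(f) √q(h)`: the polar form of the non-negative real quadratic
form `q` (the real polynomial `t ↦ q(f + t h) ≥ 0` has non-positive discriminant).
(Bombieri 2000 §4 / Yoshida 1992: `T[f * f̄*]` is a hermitian form bounded below.)
[cite: Bombieri2000Weil, §4 Problem 2 and Thm 3 (proof)] -/
theorem abs_polar_le (hf : IsWeilTest f) (hfs : tsupport f ⊆ Icc (-a) a) (hh : IsWeilTest h)
    (hhs : tsupport h ⊆ Icc (-a) a) :
    |((weilQuadratic (f + h)).re - weilGroundEnergy a * ∫ x, ‖(f + h) x‖ ^ 2) -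
        ((weilQuadratic f).re - weilGroundEnergy a * ∫ x, ‖f x‖ ^ 2) -
        ((weilQuadratic h).re - weilGroundEnergy a * ∫ x, ‖h x‖ ^ 2)| ≤
      2 * Real.sqrt ((weilQuadratic f).re - weilGroundEnergy a * ∫ x, ‖f x‖ ^ 2) *
        Real.sqrt ((weilQuadratic h).re - weilGroundEnergy a * ∫ x, ‖h x‖ ^ 2) := by
  set e := weilGroundEnergy a with he
  set qf := (weilQuadratic f).re - e * ∫ x, ‖f x‖ ^ 2 with hqf
  set qh := (weilQuadratic h).re - e * ∫ x, ‖h x‖ ^ 2 with hqh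
  set X := (weilFunctional (weilConv f (weilReflect h)) +
    weilFunctional (weilConv h (weilReflect f))).re with hX
  set P := (∫ x, f x * conj (h x)).re with hP
  -- the polar coefficient
  set ρ := X - 2 * e * P with hρ
  have hqf0 : 0 ≤ qf := by
    have := weilGroundEnergy_mul_le_re hf hfs
    simp only [hqf]; linarith
  have hqh0 : 0 ≤ qh := by
    have := weilGroundEnergy_mul_le_re hh hhs
    simp only [hqh]; linarith
  -- `q(f + t h) = qf + t² qh + t ρ` for real `t`
  have hline : ∀ t : ℝ,
      (weilQuadratic (f + fun x ↦ (t : ℂ) * h x)).re -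
          e * ∫ x, ‖(f + fun x ↦ (t : ℂ) * h x) x‖ ^ 2 =
        qf + t ^ 2 * qh + t * ρ := by
    intro t
    rw [re_weilQuadratic_add_real_mul hf hh t, integral_norm_sq_add_real_mul hf hh t]
    simp only [hqf, hqh, hρ, hX, hP]
    ring
  have hnonneg : ∀ t : ℝ, 0 ≤ qh * (t * t) + ρ * t + qf := by
    intro t
    have ht : IsWeilTest (f + fun x ↦ (t : ℂ) * h x) := hf.add (hh.const_mul t)
    have hts : tsupport (f + fun x ↦ (t : ℂ) * h x) ⊆ Icc (-a) a :=
      (tsupport_add _ _).trans (union_subset hfs (tsupport_mul_subset_right.trans hhs))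
    have h0 := weilGroundEnergy_mul_le_re ht hts
    have h1 := hline t
    nlinarith [h0, h1]
  have hdisc : discrim qh ρ qf ≤ 0 := discrim_le_zero hnonneg
  rw [discrim] at hdisc
  -- at `t = 1`
  have hone : (f + fun x ↦ ((1 : ℝ) : ℂ) * h x) = f + h := by
    funext x; simp
  have h1 := hline 1
  rw [hone] at h1
  have hval : ((weilQuadratic (f + h)).re - e * ∫ x, ‖(f + h) x‖ ^ 2) - qf - qh = ρ := by
    rw [h1]; ring
  rw [hval]
  have hρ2 : ρ ^ 2 ≤ (2 * Real.sqrt qf * Real.sqrt qh) ^ 2 := by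
    rw [mul_pow, mul_pow, Real.sq_sqrt hqf0, Real.sq_sqrt hqh0]
    nlinarith [hdisc]
  exact abs_le_of_sq_le_sq' hρ2 (by positivity) |>.elim (fun h1 h2 ↦ abs_le.2 ⟨h1, h2⟩)

/-- Upper Cauchy–Schwarz bound: `q(f + h) ≤ (√q(f) + √q(h))²` on the window. [folklore] -/
theorem shiftedForm_add_le (hf : IsWeilTest f) (hfs : tsupport f ⊆ Icc (-a) a) (hh : IsWeilTest h)
    (hhs : tsupport h ⊆ Icc (-a) a) :
    (weilQuadratic (f + h)).re - weilGroundEnergy a * ∫ x, ‖(f + h) x‖ ^ 2 ≤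
      (Real.sqrt ((weilQuadratic f).re - weilGroundEnergy a * ∫ x, ‖f x‖ ^ 2) +
        Real.sqrt ((weilQuadratic h).re - weilGroundEnergy a * ∫ x, ‖h x‖ ^ 2)) ^ 2 := by
  have hcs := abs_polar_le hf hfs hh hhs
  have hqf0 : 0 ≤ (weilQuadratic f).re - weilGroundEnergy a * ∫ x, ‖f x‖ ^ 2 := by
    have := weilGroundEnergy_mul_le_re hf hfs
    linarith
  have hqh0 : 0 ≤ (weilQuadratic h).re - weilGroundEnergy a * ∫ x, ‖h x‖ ^ 2 := by
    have := weilGroundEnergy_mul_le_re hh hhs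
    linarith
  rw [add_sq, Real.sq_sqrt hqf0, Real.sq_sqrt hqh0]
  have := (abs_le.1 hcs).2
  linarith

/-- Lower Cauchy–Schwarz bound: `q(f) − 2√q(f)√q(h) ≤ q(f + h)` on the window. [folklore] -/
theorem shiftedForm_sub_le_add (hf : IsWeilTest f) (hfs : tsupport f ⊆ Icc (-a) a)
    (hh : IsWeilTest h) (hhs : tsupport h ⊆ Icc (-a) a) :
    ((weilQuadratic f).re - weilGroundEnergy a * ∫ x, ‖f x‖ ^ 2) -
        2 * Real.sqrt ((weilQuadratic f).re - weilGroundEnergy a * ∫ x, ‖f x‖ ^ 2) *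
          Real.sqrt ((weilQuadratic h).re - weilGroundEnergy a * ∫ x, ‖h x‖ ^ 2) ≤
      (weilQuadratic (f + h)).re - weilGroundEnergy a * ∫ x, ‖(f + h) x‖ ^ 2 := by
  have hcs := abs_polar_le hf hfs hh hhs
  have hqh0 : 0 ≤ (weilQuadratic h).re - weilGroundEnergy a * ∫ x, ‖h x‖ ^ 2 := by
    have := weilGroundEnergy_mul_le_re hh hhs
    linarith
  have := (abs_le.1 hcs).1
  linarith

end Form


/-! ## §B. The spectral gap in variational form

From `WeilWindowSimpleEven a` (a gap `δ` on odd test functions and on even test functions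
orthogonal to an arbitrary witness `φ`) and a ground state `u` we derive the genuine gap
inequality `δ (‖g‖² − |⟨g, u⟩|²) ≤ q(g)` for every window test function `g` (§B4), by
two-dimensional perturbation theory along the minimising sequence (no operator is posited; this
replaces the min–max step of the proof of Connes–van Suijlekom 2025, Thm. 6.1, p. 11). -/

section L2Pairing

variable {α : Type*} [MeasurableSpace α] {μ : Measure α}

/-- Cauchy–Schwarz for two square-integrable scalar functions:
`∫ ‖A‖ ‖B‖ ≤ √(∫ ‖A‖²) √(∫ ‖B‖²)`. [folklore] -/
private theorem integral_norm_mul_norm_le_sqrt {A B : α → ℂ} (hA : MemLp A 2 μ) (hB : MemLp B 2 μ) :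
    ∫ x, ‖A x‖ * ‖B x‖ ∂μ ≤ √(∫ x, ‖A x‖ ^ 2 ∂μ) * √(∫ x, ‖B x‖ ^ 2 ∂μ) := by
  have h2 : ENNReal.ofReal 2 = 2 := by norm_num
  have hA' : MemLp (fun x => ‖A x‖) (ENNReal.ofReal 2) μ := by rw [h2]; exact hA.norm
  have hB' : MemLp (fun x => ‖B x‖) (ENNReal.ofReal 2) μ := by rw [h2]; exact hB.norm
  have h := integral_mul_le_Lp_mul_Lq_of_nonneg Real.HolderConjugate.two_two
    (ae_of_all _ fun x => norm_nonneg (A x)) (ae_of_all _ fun x => norm_nonneg (B x)) hA' hB'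
  simp only [Real.rpow_two] at h
  rw [Real.sqrt_eq_rpow, Real.sqrt_eq_rpow]
  exact h

/-- Cauchy–Schwarz: `‖∫ A B‖ ≤ √(∫ ‖A‖²) √(∫ ‖B‖²)`. [folklore] -/
private theorem norm_integral_mul_le_sqrt {A B : α → ℂ} (hA : MemLp A 2 μ) (hB : MemLp B 2 μ) :
    ‖∫ x, A x * B x ∂μ‖ ≤ √(∫ x, ‖A x‖ ^ 2 ∂μ) * √(∫ x, ‖B x‖ ^ 2 ∂μ) := by
  refine (norm_integral_le_integral_norm _).trans ?_
  simp only [norm_mul]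
  exact integral_norm_mul_norm_le_sqrt hA hB

end L2Pairing

section Pairing

variable {f h u : ℝ → ℂ}

/-- `MemLp (conj ∘ u) 2` from `MemLp u 2`. [folklore] -/
theorem memLp_conj (hu : MemLp u 2) : MemLp (fun t ↦ conj (u t)) 2 :=
  ⟨Complex.continuous_conj.comp_aestronglyMeasurable hu.1, by
    rw [show (fun t ↦ conj (u t)) = fun t ↦ (starRingEnd ℂ) (u t) from rfl]
    have : eLpNorm (fun t ↦ (starRingEnd ℂ) (u t)) 2 volume = eLpNorm u 2 volume :=
      eLpNorm_congr_norm_ae (Eventually.of_forall fun t ↦ by simp)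
    rw [this]; exact hu.2⟩

/-- `∫ ‖conj u‖² = ∫ ‖u‖²`. [folklore] -/
theorem integral_norm_sq_conj (u : ℝ → ℂ) : ∫ t, ‖conj (u t)‖ ^ 2 = ∫ t, ‖u t‖ ^ 2 := by
  simp

/-- **Continuity of the pairing `⟨f, ·⟩` in `L²`**:
`‖∫ f v̄ − ∫ f w̄‖ ≤ √∫|f|² · √∫|v − w|²`. [folklore] -/
theorem norm_integral_mul_conj_sub_le (hf : MemLp f 2) {v w : ℝ → ℂ} (hv : MemLp v 2)
    (hw : MemLp w 2) :
    ‖(∫ t, f t * conj (v t)) - ∫ t, f t * conj (w t)‖ ≤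
      √(∫ t, ‖f t‖ ^ 2) * √(∫ t, ‖v t - w t‖ ^ 2) := by
  have hi1 : Integrable fun t ↦ f t * conj (v t) := hf.integrable_mul (memLp_conj hv)
  have hi2 : Integrable fun t ↦ f t * conj (w t) := hf.integrable_mul (memLp_conj hw)
  rw [← integral_sub hi1 hi2]
  have e : (fun t ↦ f t * conj (v t) - f t * conj (w t)) = fun t ↦ f t * conj (v t - w t) := by
    funext t; simp [mul_sub]
  rw [e]
  have h := norm_integral_mul_le_sqrt hf (memLp_conj (hv.sub hw))
  simp only [Pi.sub_apply, Complex.norm_conj] at h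
  exact h

/-- **Expansion `∫|f + α h|² = ∫|f|² + |α|²∫|h|² + 2 Re(ᾱ ∫ f h̄)`** for square-integrable
`f, h` and `α : ℂ`. [folklore] -/
theorem integral_norm_sq_add_mul (hf : MemLp f 2) (hh : MemLp h 2) (α : ℂ) :
    ∫ x, ‖f x + α * h x‖ ^ 2 =
      (∫ x, ‖f x‖ ^ 2) + Complex.normSq α * (∫ x, ‖h x‖ ^ 2) +
        2 * (conj α * ∫ x, f x * conj (h x)).re := by
  have h1 : ∀ x, ‖f x + α * h x‖ ^ 2 =
      ‖f x‖ ^ 2 + Complex.normSq α * ‖h x‖ ^ 2 + 2 * (conj α * (f x * conj (h x))).re := by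
    intro x
    rw [← Complex.normSq_eq_norm_sq, ← Complex.normSq_eq_norm_sq, ← Complex.normSq_eq_norm_sq,
      Complex.normSq_add, Complex.normSq_mul, map_mul]
    have : f x * (conj α * conj (h x)) = conj α * (f x * conj (h x)) := by ring
    rw [this]
  simp_rw [h1]
  have hf2 : Integrable fun x ↦ ‖f x‖ ^ 2 := (memLp_two_iff_integrable_sq_norm hf.1).1 hf
  have hh2 : Integrable fun x ↦ ‖h x‖ ^ 2 := (memLp_two_iff_integrable_sq_norm hh.1).1 hh
  have hfh : Integrable fun x ↦ f x * conj (h x) := hf.integrable_mul (memLp_conj hh)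
  have i2 : Integrable fun x ↦ Complex.normSq α * ‖h x‖ ^ 2 := hh2.const_mul _
  have i3 : Integrable fun x ↦ 2 * (conj α * (f x * conj (h x))).re := by
    have := (hfh.const_mul (conj α)).re.const_mul 2
    simpa only [RCLike.re_to_complex] using this
  have i12 : Integrable fun x ↦ ‖f x‖ ^ 2 + Complex.normSq α * ‖h x‖ ^ 2 := hf2.add i2
  rw [integral_add i12 i3, integral_add hf2 i2, integral_const_mul, integral_const_mul]
  congr 1
  have key := integral_re (hfh.const_mul (conj α))
  simp only [RCLike.re_to_complex] at key
  rw [key, integral_const_mul]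

/-- `∫ f f̄ = ∫ |f|²` (as a complex number). [folklore] -/
theorem integral_mul_conj_self (f : ℝ → ℂ) :
    ∫ x, f x * conj (f x) = ((∫ x, ‖f x‖ ^ 2 : ℝ) : ℂ) := by
  rw [← integral_complex_ofReal]
  congr 1 with x
  rw [Complex.mul_conj, Complex.normSq_eq_norm_sq]

/-- **Pythagoras along a unit vector.** If `∫|e|² = 1` and `c = ∫ f ē` then
`∫|f − c e|² = ∫|f|² − |c|²`. [folklore] -/
theorem integral_norm_sq_sub_proj (hf : MemLp f 2) {e : ℝ → ℂ} (he : MemLp e 2)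
    (he1 : ∫ x, ‖e x‖ ^ 2 = 1) :
    ∫ x, ‖f x + -(∫ y, f y * conj (e y)) * e x‖ ^ 2 =
      (∫ x, ‖f x‖ ^ 2) - ‖∫ y, f y * conj (e y)‖ ^ 2 := by
  rw [integral_norm_sq_add_mul hf he, he1, mul_one, Complex.normSq_neg, map_neg,
    Complex.normSq_eq_norm_sq]
  set c := ∫ y, f y * conj (e y)
  have : (-conj c * c).re = -‖c‖ ^ 2 := by
    rw [neg_mul, Complex.neg_re, mul_comm, Complex.mul_conj, Complex.normSq_eq_norm_sq]
    norm_cast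
  rw [this]
  ring

/-- The residual `f − ⟨f, e⟩ e` is orthogonal to the unit vector `e`. [folklore] -/
theorem integral_sub_proj_mul_conj (hf : MemLp f 2) {e : ℝ → ℂ} (he : MemLp e 2)
    (he1 : ∫ x, ‖e x‖ ^ 2 = 1) :
    ∫ x, (f x + -(∫ y, f y * conj (e y)) * e x) * conj (e x) = 0 := by
  have hfe : Integrable fun x ↦ f x * conj (e x) := hf.integrable_mul (memLp_conj he)
  have hee : Integrable fun x ↦ e x * conj (e x) := he.integrable_mul (memLp_conj he)
  have e1 : (fun x ↦ (f x + -(∫ y, f y * conj (e y)) * e x) * conj (e x)) =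
      fun x ↦ f x * conj (e x) + -(∫ y, f y * conj (e y)) * (e x * conj (e x)) := by
    funext x; ring
  rw [e1, integral_add hfe (hee.const_mul _), integral_const_mul, integral_mul_conj_self, he1]
  push_cast
  ring

/-- **Pythagoras for an orthogonal pair**: if `∫ p ē = 0` and `∫|e|² = 1` then
`∫|p + t e|² = ∫|p|² + |t|²`. [folklore] -/
theorem integral_norm_sq_add_mul_of_orthogonal {p e : ℝ → ℂ} (hp : MemLp p 2) (he : MemLp e 2)
    (he1 : ∫ x, ‖e x‖ ^ 2 = 1) (horth : ∫ x, p x * conj (e x) = 0) (t : ℂ) :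
    ∫ x, ‖p x + t * e x‖ ^ 2 = (∫ x, ‖p x‖ ^ 2) + ‖t‖ ^ 2 := by
  rw [integral_norm_sq_add_mul hp he, he1, horth, mul_zero, Complex.zero_re, mul_zero, add_zero,
    mul_one, Complex.normSq_eq_norm_sq]

end Pairing

section Hypothesis

variable {a : ℝ} {e g k : ℝ → ℂ}

/-- **Un-normalising a bound on the unit sphere.** If `E ≤ Re Q(c e)` for every `c > 0` with
`∫|c e|² = 1`, then `E ∫|e|² ≤ Re Q(e)` (homogeneity `Q(c e) = c² Q(e)`; for `∫|e|² = 0`,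
`e = 0` and `Q(0) = 0`). [folklore] -/
theorem mul_integral_le_re_of_sphere (he : IsWeilTest e) {E : ℝ}
    (h : ∀ c : ℝ, 0 < c → ∫ t, ‖(c : ℂ) * e t‖ ^ 2 = (1 : ℝ) →
      E ≤ (weilQuadratic fun t ↦ (c : ℂ) * e t).re) :
    E * ∫ t, ‖e t‖ ^ 2 ≤ (weilQuadratic e).re := by
  have hN2nn : 0 ≤ ∫ t : ℝ, ‖e t‖ ^ 2 := integral_nonneg fun _ ↦ by positivity
  rcases hN2nn.eq_or_lt with hz | hpos
  · have he0 : e = 0 := he.eq_zero_of_integral_norm_sq_eq_zero hz.symm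
    subst he0
    rw [weilQuadratic_zero, Complex.zero_re, ← hz, mul_zero]
  · set N2 : ℝ := ∫ t : ℝ, ‖e t‖ ^ 2 with hN2
    set c : ℝ := (Real.sqrt N2)⁻¹ with hc
    have hcpos : 0 < c := inv_pos.2 (Real.sqrt_pos.2 hpos)
    have hnorm' : ∫ t : ℝ, ‖(c : ℂ) * e t‖ ^ 2 = 1 := by
      simp only [norm_mul, mul_pow, Complex.norm_real, Real.norm_of_nonneg hcpos.le]
      rw [integral_const_mul, hc, inv_pow, Real.sq_sqrt hN2nn, inv_mul_cancel₀ hpos.ne']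
    have hle := h c hcpos hnorm'
    have hQ' : (weilQuadratic fun t ↦ (c : ℂ) * e t).re = c * c * (weilQuadratic e).re := by
      rw [weilQuadratic_const_mul, Complex.normSq_ofReal, Complex.re_ofReal_mul]
    have hcc : c * c * N2 = 1 := by
      rw [hc, ← mul_inv, Real.mul_self_sqrt hN2nn, inv_mul_cancel₀ hpos.ne']
    have h1 : E * (c * c * N2) ≤ c * c * (weilQuadratic e).re := by
      rw [hcc, mul_one, ← hQ']
      exact hle
    have h2 : c * c * (E * N2) ≤ c * c * (weilQuadratic e).re := by linarith
    exact le_of_mul_le_mul_left h2 (mul_pos hcpos hcpos)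

/-- `∫ conj φ · (c e) = c ∫ conj φ · e` (no hypotheses: both sides carry the same junk value). [folklore] -/
theorem integral_conj_mul_const_mul (φ e : ℝ → ℂ) (c : ℂ) :
    ∫ t, conj (φ t) * (c * e t) = c * ∫ t, conj (φ t) * e t := by
  rw [← integral_const_mul]
  congr 1 with t
  ring

/-- The clause of `WeilWindowSimpleEven a` for EVEN test functions, un-normalised: if `e` is an
even test function on the window with `∫ conj φ · e = 0` then `(ε(a) + δ) ∫|e|² ≤ Re Q(e)`.
[cite: ConnesSuijlekom2025, Thm. 6.1 (hypothesis)] -/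
theorem gap_even {φ : ℝ → ℂ} {δ : ℝ}
    (hH : ∀ g : ℝ → ℂ, IsWeilTest g → tsupport g ⊆ Icc (-a) a →
      ∫ t, ‖g t‖ ^ 2 = (1 : ℝ) →
        ((∀ t, g (-t) = -g t) ∨ ((∀ t, g (-t) = g t) ∧ ∫ t, conj (φ t) * g t = 0)) →
          weilGroundEnergy a + δ ≤ (weilQuadratic g).re)
    (he : IsWeilTest e) (hes : tsupport e ⊆ Icc (-a) a) (hev : ∀ t, e (-t) = e t)
    (horth : ∫ t, conj (φ t) * e t = 0) :
    (weilGroundEnergy a + δ) * ∫ t, ‖e t‖ ^ 2 ≤ (weilQuadratic e).re := by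
  refine mul_integral_le_re_of_sphere he fun c _ hnorm ↦ ?_
  refine hH _ (he.const_mul c) (tsupport_mul_subset_right.trans hes) hnorm (Or.inr ⟨?_, ?_⟩)
  · intro t
    simp only [hev]
  · rw [integral_conj_mul_const_mul, horth, mul_zero]

/-- The clause of `WeilWindowSimpleEven a` for ODD test functions, un-normalised:
`(ε(a) + δ) ∫|o|² ≤ Re Q(o)`. [cite: ConnesSuijlekom2025, Thm. 6.1 (hypothesis)] -/
theorem gap_odd {φ : ℝ → ℂ} {δ : ℝ}
    (hH : ∀ g : ℝ → ℂ, IsWeilTest g → tsupport g ⊆ Icc (-a) a →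
      ∫ t, ‖g t‖ ^ 2 = (1 : ℝ) →
        ((∀ t, g (-t) = -g t) ∨ ((∀ t, g (-t) = g t) ∧ ∫ t, conj (φ t) * g t = 0)) →
          weilGroundEnergy a + δ ≤ (weilQuadratic g).re)
    (ho : IsWeilTest e) (hos : tsupport e ⊆ Icc (-a) a) (hodd : ∀ t, e (-t) = -e t) :
    (weilGroundEnergy a + δ) * ∫ t, ‖e t‖ ^ 2 ≤ (weilQuadratic e).re := by
  refine mul_integral_le_re_of_sphere ho fun c _ hnorm ↦ ?_
  refine hH _ (ho.const_mul c) (tsupport_mul_subset_right.trans hos) hnorm (Or.inl fun t ↦ ?_)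
  simp only [hodd, mul_neg]

/-- The reflection of a function supported in the symmetric window is supported there. [folklore] -/
theorem tsupport_comp_neg_subset (hgs : tsupport g ⊆ Icc (-a) a) :
    tsupport (fun t ↦ g (-t)) ⊆ Icc (-a) a := by
  intro x hx
  have hx' : -x ∈ tsupport g := by
    have e : (fun t ↦ g (-t)) = g ∘ (Homeomorph.neg ℝ) := rfl
    rw [e, tsupport_comp_eq_preimage] at hx
    simpa using hx
  have := hgs hx'
  simp only [mem_Icc] at this ⊢
  constructor <;> linarith [this.1, this.2]

/-- The even and odd parts of a function on the symmetric window live on the window. [folklore] -/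
theorem tsupport_evenPart_subset (hgs : tsupport g ⊆ Icc (-a) a) (σ : ℂ) :
    tsupport (fun t ↦ (g t + σ * g (-t)) / 2) ⊆ Icc (-a) a := by
  have e : (fun t ↦ (g t + σ * g (-t)) / 2) =
      fun t ↦ (1 / 2 : ℂ) * (g + fun t ↦ σ * g (-t)) t := by
    funext t; simp only [Pi.add_apply]; ring
  rw [e]
  refine tsupport_mul_subset_right.trans ((tsupport_add _ _).trans (union_subset hgs ?_))
  exact tsupport_mul_subset_right.trans (tsupport_comp_neg_subset hgs)

/-- `∫|g|² = ∫|gₑ|² + ∫|gₒ|²` for the even/odd parts of a square-integrable `g`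
(the cross term `∫ gₑ ḡₒ` has an odd integrand). [folklore] -/
theorem integral_norm_sq_eq_evenPart_add_oddPart (hg : IsWeilTest g) :
    ∫ t, ‖g t‖ ^ 2 =
      (∫ t, ‖(g t + g (-t)) / 2‖ ^ 2) + ∫ t, ‖(g t - g (-t)) / 2‖ ^ 2 := by
  have hge : IsWeilTest fun t ↦ (g t + g (-t)) / 2 := isWeilTest_evenPart hg
  have hgo : IsWeilTest fun t ↦ (g t - g (-t)) / 2 := isWeilTest_oddPart hg
  have hsum : ∀ t, g t = (g t + g (-t)) / 2 + 1 * ((g t - g (-t)) / 2) := fun t ↦ by ring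
  have hcross : ∫ t, (g t + g (-t)) / 2 * conj ((g t - g (-t)) / 2) = 0 := by
    set F : ℝ → ℂ := fun t ↦ (g t + g (-t)) / 2 * conj ((g t - g (-t)) / 2) with hF
    have hodd : ∀ t, F (-t) = -F t := by
      intro t
      simp only [hF, neg_neg, map_div₀, map_sub]
      ring
    have h1 : ∫ t, F (-t) = ∫ t, F t := integral_neg_eq_self F volume
    have h2 : ∫ t, F (-t) = -∫ t, F t := by
      rw [← integral_neg]; exact integral_congr_ae (Eventually.of_forall hodd)
    have : ∫ t, F t = 0 := by linear_combination (h1.symm.trans h2) / 2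
    exact this
  conv_lhs => rw [show (fun t ↦ ‖g t‖ ^ 2) = fun t ↦ ‖(g t + g (-t)) / 2 + 1 * ((g t - g (-t)) / 2)‖ ^ 2
    from funext fun t ↦ by rw [← hsum t]]
  rw [integral_norm_sq_add_mul (isWeilTest_memLp hge) (isWeilTest_memLp hgo), hcross]
  simp

/-- **The gap on the constrained hyperplane.** Under the clause of `WeilWindowSimpleEven a`
(witness `φ`, gap `δ`): a window test function `k` whose even part is orthogonal to `φ`
satisfies `(ε(a) + δ) ∫|k|² ≤ Re Q(k)` (parity splitting of `Q` and of `∫|·|²`).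
[cite: ConnesSuijlekom2025, Thm. 6.1 (proof, p. 11: Q ≥ (λ+δ)‖α‖² on the complement)] -/
theorem gap_of_evenPart_orthogonal {φ : ℝ → ℂ} {δ : ℝ}
    (hH : ∀ g : ℝ → ℂ, IsWeilTest g → tsupport g ⊆ Icc (-a) a →
      ∫ t, ‖g t‖ ^ 2 = (1 : ℝ) →
        ((∀ t, g (-t) = -g t) ∨ ((∀ t, g (-t) = g t) ∧ ∫ t, conj (φ t) * g t = 0)) →
          weilGroundEnergy a + δ ≤ (weilQuadratic g).re)
    (hk : IsWeilTest k) (hks : tsupport k ⊆ Icc (-a) a)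
    (horth : ∫ t, conj (φ t) * ((k t + k (-t)) / 2) = 0) :
    (weilGroundEnergy a + δ) * ∫ t, ‖k t‖ ^ 2 ≤ (weilQuadratic k).re := by
  have hke : IsWeilTest fun t ↦ (k t + k (-t)) / 2 := isWeilTest_evenPart hk
  have hko : IsWeilTest fun t ↦ (k t - k (-t)) / 2 := isWeilTest_oddPart hk
  have hkes : tsupport (fun t ↦ (k t + k (-t)) / 2) ⊆ Icc (-a) a := by
    simpa using tsupport_evenPart_subset hks 1
  have hkos : tsupport (fun t ↦ (k t - k (-t)) / 2) ⊆ Icc (-a) a := by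
    have := tsupport_evenPart_subset hks (-1)
    simpa [sub_eq_add_neg] using this
  have h1 := gap_even hH hke hkes (fun t ↦ by simp only [neg_neg]; ring) horth
  have h2 := gap_odd hH hko hkos (fun t ↦ by simp only [neg_neg]; ring)
  rw [integral_norm_sq_eq_evenPart_add_oddPart hk, weilQuadratic_eq_evenPart_add_oddPart hk,
    Complex.add_re]
  linarith

end Hypothesis

section Gap

variable {a : ℝ} {u g gm : ℝ → ℂ}

/-- Homogeneity of the shifted form: `q(c f) = |c|² q(f)`. [folklore] -/
theorem shiftedForm_const_mul (c : ℂ) (f : ℝ → ℂ) :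
    (weilQuadratic fun t ↦ c * f t).re - weilGroundEnergy a * ∫ t, ‖c * f t‖ ^ 2 =
      ‖c‖ ^ 2 * ((weilQuadratic f).re - weilGroundEnergy a * ∫ t, ‖f t‖ ^ 2) := by
  rw [weilQuadratic_const_mul, Complex.re_ofReal_mul]
  simp only [norm_mul, mul_pow]
  rw [integral_const_mul, Complex.normSq_eq_norm_sq]
  ring

/-- Junk-safe linear algebra of the constraint `∫ conj φ · (·)ₑ = 0`: if the even part of `e`
pairs non-trivially with `φ` and `τ · ⟨φ, eₑ⟩ = ⟨φ, pₑ⟩`, then the even part of `p − τ e` is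
orthogonal to `φ` — whether or not `conj φ · pₑ` is integrable (if it is not, neither is the
integrand of the conclusion, and both integrals vanish by convention). [folklore] -/
theorem evenPart_orthogonal_sub {φ p e : ℝ → ℂ} {τ : ℂ}
    (hIe : ∫ t, conj (φ t) * ((e t + e (-t)) / 2) ≠ 0)
    (hτ : τ * ∫ t, conj (φ t) * ((e t + e (-t)) / 2) = ∫ t, conj (φ t) * ((p t + p (-t)) / 2)) :
    ∫ t, conj (φ t) * (((p t + -τ * e t) + (p (-t) + -τ * e (-t))) / 2) = 0 := by
  have e1 : (fun t ↦ conj (φ t) * (((p t + -τ * e t) + (p (-t) + -τ * e (-t))) / 2)) =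
      fun t ↦ conj (φ t) * ((p t + p (-t)) / 2) + (-τ) * (conj (φ t) * ((e t + e (-t)) / 2)) := by
    funext t; ring
  rw [e1]
  have hint2 : Integrable (fun t ↦ conj (φ t) * ((e t + e (-t)) / 2)) := by
    by_contra h; exact hIe (integral_undef h)
  by_cases hint : Integrable (fun t ↦ conj (φ t) * ((p t + p (-t)) / 2))
  · rw [integral_add hint (hint2.const_mul _), integral_const_mul, ← hτ]
    ring
  · have hni : ¬ Integrable (fun t ↦ conj (φ t) * ((p t + p (-t)) / 2) +
        (-τ) * (conj (φ t) * ((e t + e (-t)) / 2))) := by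
      intro h
      apply hint
      have h' := h.sub (hint2.const_mul (-τ))
      refine h'.congr (Eventually.of_forall fun t ↦ ?_)
      simp only [Pi.sub_apply]
      ring
    exact integral_undef hni

/-- **Two-dimensional perturbation step** (the finite-dimensional heart of the gap lemma).
Assume the clause of `WeilWindowSimpleEven a` with witness `φ` and gap `δ > 0`. Let `g` be a
window test function (`N = ∫|g|²`, `q_g = q(g)`), and `gₘ` a NORMALISED window test function
with small energy `η = q(gₘ) ≤ δ/16`; put `c = ⟨g, gₘ⟩`. Then
`δ (1 − 2√(η/δ)) (N − |c|²) − 2 (√q_g + √N √η) √N √η ≤ q_g`.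
Proof: `p = g − c gₘ ⊥ gₘ`; some `k = p − τ gₘ` has even part `⊥ φ` (junk-safe), so
`q(k) ≥ δ‖k‖² = δ(‖p‖² + |τ|²)`; Cauchy–Schwarz for `q` twice (`p = k + τgₘ`, `g = p + cgₘ`).
[cite: ConnesSuijlekom2025, Thm. 6.1 (proof, p. 11)] -/
theorem gap_step {φ : ℝ → ℂ} {δ : ℝ} (hδ : 0 < δ)
    (hH : ∀ g : ℝ → ℂ, IsWeilTest g → tsupport g ⊆ Icc (-a) a →
      ∫ t, ‖g t‖ ^ 2 = (1 : ℝ) →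
        ((∀ t, g (-t) = -g t) ∨ ((∀ t, g (-t) = g t) ∧ ∫ t, conj (φ t) * g t = 0)) →
          weilGroundEnergy a + δ ≤ (weilQuadratic g).re)
    (hg : IsWeilTest g) (hgs : tsupport g ⊆ Icc (-a) a)
    (hm : IsWeilTest gm) (hms : tsupport gm ⊆ Icc (-a) a) (hm1 : ∫ t, ‖gm t‖ ^ 2 = (1 : ℝ))
    (hη : (weilQuadratic gm).re - weilGroundEnergy a * ∫ t, ‖gm t‖ ^ 2 ≤ δ / 16) :
    δ * (1 - 2 * √(((weilQuadratic gm).re - weilGroundEnergy a * ∫ t, ‖gm t‖ ^ 2) / δ)) *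
        ((∫ t, ‖g t‖ ^ 2) - ‖∫ t, g t * conj (gm t)‖ ^ 2) -
      2 * (√((weilQuadratic g).re - weilGroundEnergy a * ∫ t, ‖g t‖ ^ 2) +
          √(∫ t, ‖g t‖ ^ 2) * √((weilQuadratic gm).re - weilGroundEnergy a * ∫ t, ‖gm t‖ ^ 2)) *
        (√(∫ t, ‖g t‖ ^ 2) * √((weilQuadratic gm).re - weilGroundEnergy a * ∫ t, ‖gm t‖ ^ 2)) ≤
      (weilQuadratic g).re - weilGroundEnergy a * ∫ t, ‖g t‖ ^ 2 := by
  set ε := weilGroundEnergy a with hε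
  set N := ∫ t, ‖g t‖ ^ 2 with hN
  set c := ∫ t, g t * conj (gm t) with hc
  set Qg := (weilQuadratic g).re - ε * N with hQg
  set η := (weilQuadratic gm).re - ε * ∫ t, ‖gm t‖ ^ 2 with hηdef
  have hgL := isWeilTest_memLp hg
  have hmL := isWeilTest_memLp hm
  have hQg0 : 0 ≤ Qg := by
    have := weilGroundEnergy_mul_le_re hg hgs
    simp only [hQg]; linarith
  have hη0 : 0 ≤ η := by
    have := weilGroundEnergy_mul_le_re hm hms
    simp only [hηdef]; linarith
  have hN0 : 0 ≤ N := integral_nonneg fun _ ↦ by positivity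
  -- the even-part pairing with `φ`
  have hIm : ∫ t, conj (φ t) * ((gm t + gm (-t)) / 2) ≠ 0 := by
    intro h0
    have h1 := gap_of_evenPart_orthogonal hH hm hms h0
    rw [hm1, mul_one] at h1
    have : δ ≤ η := by simp only [hηdef, hm1, mul_one]; linarith
    linarith
  -- `p = g - c gm ⊥ gm`
  set p : ℝ → ℂ := fun t ↦ g t + -c * gm t with hpdef
  have hp : IsWeilTest p := hg.add (hm.const_mul (-c))
  have hps : tsupport p ⊆ Icc (-a) a :=
    (tsupport_add _ _).trans (union_subset hgs (tsupport_mul_subset_right.trans hms))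
  have hpL := isWeilTest_memLp hp
  have hpN : ∫ t, ‖p t‖ ^ 2 = N - ‖c‖ ^ 2 := integral_norm_sq_sub_proj hgL hmL hm1
  have hporth : ∫ t, p t * conj (gm t) = 0 := integral_sub_proj_mul_conj hgL hmL hm1
  have hcN : ‖c‖ ^ 2 ≤ N := by
    have : 0 ≤ ∫ t, ‖p t‖ ^ 2 := integral_nonneg fun _ ↦ by positivity
    linarith
  -- `k = p - τ gm` with even part orthogonal to `φ`
  set τ : ℂ := (∫ t, conj (φ t) * ((p t + p (-t)) / 2)) / ∫ t, conj (φ t) * ((gm t + gm (-t)) / 2)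
    with hτdef
  have hτ : τ * ∫ t, conj (φ t) * ((gm t + gm (-t)) / 2) = ∫ t, conj (φ t) * ((p t + p (-t)) / 2) :=
    div_mul_cancel₀ _ hIm
  set k : ℝ → ℂ := fun t ↦ p t + -τ * gm t with hkdef
  have hk : IsWeilTest k := hp.add (hm.const_mul (-τ))
  have hks : tsupport k ⊆ Icc (-a) a :=
    (tsupport_add _ _).trans (union_subset hps (tsupport_mul_subset_right.trans hms))
  have hkorth : ∫ t, conj (φ t) * ((k t + k (-t)) / 2) = 0 := evenPart_orthogonal_sub hIm hτ
  have hkN : ∫ t, ‖k t‖ ^ 2 = (N - ‖c‖ ^ 2) + ‖τ‖ ^ 2 := by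
    rw [← hpN]
    have := integral_norm_sq_add_mul_of_orthogonal hpL hmL hm1 hporth (-τ)
    rwa [norm_neg] at this
  set qk := (weilQuadratic k).re - ε * ∫ t, ‖k t‖ ^ 2 with hqkdef
  have hqk : δ * ((N - ‖c‖ ^ 2) + ‖τ‖ ^ 2) ≤ qk := by
    have := gap_of_evenPart_orthogonal hH hk hks hkorth
    rw [hkN] at this
    simp only [hqkdef, hkN]
    linarith
  have hqk0 : 0 ≤ qk := by nlinarith [norm_nonneg c, norm_nonneg τ]
  have hτle : ‖τ‖ ≤ √(qk / δ) := by
    refine Real.le_sqrt_of_sq_le ?_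
    rw [le_div_iff₀ hδ]
    nlinarith [norm_nonneg c]
  -- Cauchy–Schwarz 1: `p = k + τ gm`
  set qp := (weilQuadratic p).re - ε * ∫ t, ‖p t‖ ^ 2 with hqpdef
  have hp_eq : (k + fun t ↦ τ * gm t) = p := by
    funext t; simp only [Pi.add_apply, hkdef]; ring
  have hτm : IsWeilTest fun t ↦ τ * gm t := hm.const_mul τ
  have hτms : tsupport (fun t ↦ τ * gm t) ⊆ Icc (-a) a := tsupport_mul_subset_right.trans hms
  have lb1 : qk - 2 * √qk * (‖τ‖ * √η) ≤ qp := by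
    have h := shiftedForm_sub_le_add hk hks hτm hτms
    rw [hp_eq, shiftedForm_const_mul, Real.sqrt_mul (sq_nonneg _), Real.sqrt_sq (norm_nonneg _)] at h
    exact h
  have hsq : √qk * ‖τ‖ ≤ qk / √δ := by
    have h1 : √qk * ‖τ‖ ≤ √qk * √(qk / δ) := mul_le_mul_of_nonneg_left hτle (Real.sqrt_nonneg _)
    rw [Real.sqrt_div hqk0, ← mul_div_assoc, Real.mul_self_sqrt hqk0] at h1
    exact h1
  have hone : 0 ≤ 1 - 2 * √(η / δ) := by
    have h16 : √(η / δ) ≤ √(1 / 16) :=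
      Real.sqrt_le_sqrt (by rw [div_le_iff₀ hδ]; linarith)
    have e16 : √(1 / 16 : ℝ) = 1 / 4 := by
      rw [show (1 / 16 : ℝ) = (1 / 4) ^ 2 by norm_num, Real.sqrt_sq (by norm_num)]
    rw [e16] at h16
    linarith
  have lb1' : δ * (1 - 2 * √(η / δ)) * (N - ‖c‖ ^ 2) ≤ qp := by
    have h2 : 2 * √qk * (‖τ‖ * √η) ≤ 2 * qk * √(η / δ) := by
      have h' : √qk * (‖τ‖ * √η) ≤ qk / √δ * √η := by
        rw [← mul_assoc]; exact mul_le_mul_of_nonneg_right hsq (Real.sqrt_nonneg _)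
      rw [Real.sqrt_div hη0]
      have e : qk / √δ * √η = qk * (√η / √δ) := by ring
      rw [e] at h'
      linarith
    have h3 : qk * (1 - 2 * √(η / δ)) ≤ qp := by nlinarith
    have h4 : δ * (N - ‖c‖ ^ 2) ≤ qk := by nlinarith [norm_nonneg τ]
    nlinarith
  -- Cauchy–Schwarz 2: `g = p + c gm`
  have hg_eq : (p + fun t ↦ c * gm t) = g := by
    funext t; simp only [Pi.add_apply, hpdef]; ring
  have hcm : IsWeilTest fun t ↦ c * gm t := hm.const_mul c
  have hcms : tsupport (fun t ↦ c * gm t) ⊆ Icc (-a) a := tsupport_mul_subset_right.trans hms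
  have lb2 : qp - 2 * √qp * (‖c‖ * √η) ≤ Qg := by
    have h := shiftedForm_sub_le_add hp hps hcm hcms
    rw [hg_eq, shiftedForm_const_mul, Real.sqrt_mul (sq_nonneg _), Real.sqrt_sq (norm_nonneg _)] at h
    exact h
  -- upper bound on `qp`: `p = g + (-c) gm`
  have hp_eq' : (g + fun t ↦ (-c) * gm t) = p := by
    funext t; simp only [Pi.add_apply, hpdef]
  have hncm : IsWeilTest fun t ↦ (-c) * gm t := hm.const_mul (-c)
  have hncms : tsupport (fun t ↦ (-c) * gm t) ⊆ Icc (-a) a := tsupport_mul_subset_right.trans hms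
  have ub : qp ≤ (√Qg + ‖c‖ * √η) ^ 2 := by
    have h := shiftedForm_add_le hg hgs hncm hncms
    rw [hp_eq', shiftedForm_const_mul, norm_neg, Real.sqrt_mul (sq_nonneg _),
      Real.sqrt_sq (norm_nonneg _)] at h
    exact h
  have hqp0 : 0 ≤ qp := by
    have := weilGroundEnergy_mul_le_re hp hps
    simp only [hqpdef]; linarith
  have hcle : ‖c‖ ≤ √N := Real.le_sqrt_of_sq_le hcN
  have hsqp : √qp ≤ √Qg + √N * √η := by
    calc √qp ≤ √((√Qg + ‖c‖ * √η) ^ 2) := Real.sqrt_le_sqrt ub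
      _ = √Qg + ‖c‖ * √η := Real.sqrt_sq (by positivity)
      _ ≤ √Qg + √N * √η := by
          have := mul_le_mul_of_nonneg_right hcle (Real.sqrt_nonneg η)
          linarith
  have lb2' : qp - 2 * (√Qg + √N * √η) * (√N * √η) ≤ Qg := by
    have h1 : √qp * (‖c‖ * √η) ≤ (√Qg + √N * √η) * (√N * √η) := by
      refine mul_le_mul hsqp (mul_le_mul_of_nonneg_right hcle (Real.sqrt_nonneg _))
        (by positivity) (by positivity)
    linarith
  linarith

end Gap

section GapLimit

variable {a : ℝ} {u g : ℝ → ℂ}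

/-- The pairings `⟨g, gₘ⟩` along an `L²`-convergent sequence converge: `∫ g ḡₘ → ∫ g ū`. [folklore] -/
theorem tendsto_integral_mul_conj (hg : MemLp g 2) (hu : MemLp u 2) {gs : ℕ → ℝ → ℂ}
    (hgs : ∀ m, MemLp (gs m) 2) (hlim : Tendsto (fun m ↦ ∫ t, ‖gs m t - u t‖ ^ 2) atTop (𝓝 0)) :
    Tendsto (fun m ↦ ∫ t, g t * conj (gs m t)) atTop (𝓝 (∫ t, g t * conj (u t))) := by
  rw [tendsto_iff_norm_sub_tendsto_zero]
  refine squeeze_zero (fun _ ↦ norm_nonneg _)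
    (fun m ↦ norm_integral_mul_conj_sub_le hg (hgs m) hu) ?_
  have h := hlim.sqrt
  rw [Real.sqrt_zero] at h
  simpa using h.const_mul (√(∫ t, ‖g t‖ ^ 2))

/-- **The gap lemma.** If the bottom of the truncated Weil form on `[-a, a]` is simple, isolated
and even in the variational sense `WeilWindowSimpleEven a` (gap `δ`), and `u` is a ground state
(`IsWeilGroundState a u`), then for every test function `g` on the window
`δ · (‖g‖₂² − |⟨g, u⟩|²) ≤ Re Q(g) − ε(a)‖g‖₂²`:
the form exceeds its bottom by `δ` times the squared distance to `ℂ u`. (This is the inequality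
"`⟨α ∣ α⟩_Q ≥ (λ + δ)‖α‖²` for `α ⊥ ξ`" of the proof of Connes–van Suijlekom 2025, Thm. 6.1,
p. 11, here DERIVED from the clause with an arbitrary witness `φ` by letting `m → ∞` in
`gap_step` along the minimising sequence `gₘ → u`.)
[cite: ConnesSuijlekom2025, Thm. 6.1 (proof, p. 11)] -/
theorem gap_inequality (hW : WeilWindowSimpleEven a) (hu : IsWeilGroundState a u) :
    ∃ δ : ℝ, 0 < δ ∧ ∀ g : ℝ → ℂ, IsWeilTest g → tsupport g ⊆ Icc (-a) a →
      δ * ((∫ t, ‖g t‖ ^ 2) - ‖∫ t, g t * conj (u t)‖ ^ 2) ≤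
        (weilQuadratic g).re - weilGroundEnergy a * ∫ t, ‖g t‖ ^ 2 := by
  obtain ⟨φ, δ, hδ, hH⟩ := hW
  refine ⟨δ, hδ, fun g hg hgs ↦ ?_⟩
  obtain ⟨huL, gs, hgs_all, hQ, hL2⟩ := hu
  set ε := weilGroundEnergy a with hε
  set N := ∫ t, ‖g t‖ ^ 2 with hN
  set Qg := (weilQuadratic g).re - ε * N with hQg
  set cu := ∫ t, g t * conj (u t) with hcu
  -- the energies `η m = q(g_m) → 0`
  set η : ℕ → ℝ := fun m ↦ (weilQuadratic (gs m)).re - ε * ∫ t, ‖gs m t‖ ^ 2 with hηdef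
  have hη_eq : η = fun m ↦ (weilQuadratic (gs m)).re - ε := by
    funext m; simp only [hηdef, (hgs_all m).2.2, mul_one]
  have hηt : Tendsto η atTop (𝓝 0) := by
    rw [hη_eq]
    have := hQ.sub_const ε
    simpa using this
  have hη_small : ∀ᶠ m in atTop, η m ≤ δ / 16 :=
    Filter.Tendsto.eventually_le_const (by positivity) hηt
  -- the pairings `c m = ⟨g, g_m⟩ → ⟨g, u⟩`
  set c : ℕ → ℂ := fun m ↦ ∫ t, g t * conj (gs m t) with hcdef
  have hct : Tendsto c atTop (𝓝 cu) :=
    tendsto_integral_mul_conj (isWeilTest_memLp hg) huL (fun m ↦ isWeilTest_memLp (hgs_all m).1) hL2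
  -- the lower bounds of `gap_step`, as a continuous function of `(η m, c m)`
  set F : ℝ × ℂ → ℝ := fun p ↦ δ * (1 - 2 * √(p.1 / δ)) * (N - ‖p.2‖ ^ 2) -
    2 * (√Qg + √N * √p.1) * (√N * √p.1) with hF
  have hFc : Continuous F := by
    simp only [hF]
    fun_prop
  have hstep : ∀ᶠ m in atTop, F (η m, c m) ≤ Qg :=
    hη_small.mono fun m hm ↦ gap_step hδ hH hg hgs (hgs_all m).1 (hgs_all m).2.1 (hgs_all m).2.2 hm
  have hlim : Tendsto (fun m ↦ F (η m, c m)) atTop (𝓝 (F (0, cu))) :=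
    (hFc.tendsto _).comp (hηt.prodMk_nhds hct)
  have hF0 : F (0, cu) = δ * (N - ‖cu‖ ^ 2) := by
    simp only [hF, zero_div, Real.sqrt_zero, mul_zero, sub_zero, mul_one, add_zero]
  rw [hF0] at hlim
  exact le_of_tendsto hlim hstep

end GapLimit

/-! ## §C. Factoring out a zero of `û`

If `û(s₀) = ∫ u e^{(s₀ - 1/2)t} dt = 0`, write `w = s₀ − 1/2`. A window test function `g` with
`ĝ(s₀) = 0` is `g = v' + w v` for the window test function `v(t) = e^{-wt} ∫_{-a}^t g(τ) e^{wτ} dτ`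
(it vanishes for `t ≥ a` precisely because `ĝ(s₀) = 0`). -/

section Bump

variable {a : ℝ}

/-- For `a > 0` and every `s : ℂ` there is a test function `h` on the window `[-a, a]` with
`ĥ(s) ≠ 0` (a narrow non-negative bump: the real part of the integrand of `ĥ(s)` is `≥ 0` and
positive at `0`). [folklore] -/
theorem exists_isWeilTest_weilMellin_ne_zero (ha : 0 < a) (s : ℂ) :
    ∃ h : ℝ → ℂ, IsWeilTest h ∧ tsupport h ⊆ Icc (-a) a ∧ weilMellin h s ≠ 0 := by
  set σ : ℝ := s.re with hσ
  set γ : ℝ := s.im with hγ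
  set δ : ℝ := min a (1 / (1 + |γ|)) with hδ
  have hδpos : 0 < δ := lt_min ha (by positivity)
  have hδa : δ ≤ a := min_le_left _ _
  have hδγ : δ ≤ 1 / (1 + |γ|) := min_le_right _ _
  let b : ContDiffBump (0 : ℝ) := ⟨δ / 2, δ, by positivity, by linarith⟩
  refine ⟨fun t ↦ ((b t : ℝ) : ℂ), ⟨?_, ?_⟩, ?_, ?_⟩
  · exact Complex.ofRealCLM.contDiff.comp b.contDiff
  · exact b.hasCompactSupport.comp_left Complex.ofReal_zero
  · refine (tsupport_comp_subset Complex.ofReal_zero _).trans ?_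
    rw [b.tsupport_eq, Real.closedBall_eq_Icc, zero_sub, zero_add]
    exact Icc_subset_Icc (by linarith) hδa
  · have hs : s = σ + γ * I := (Complex.re_add_im s).symm
    rw [hs]
    -- the integrand has real part `b(t) e^{(σ-1/2)t} cos(γ t) ≥ 0`, positive at `t = 0`
    set F : ℝ → ℝ := fun t ↦ b t * Real.exp ((σ - 1 / 2) * t) * Real.cos (γ * t) with hF
    have hint : Integrable fun t : ℝ ↦ ((b t : ℝ) : ℂ) * cexp ((σ + γ * I - 1 / 2) * t) :=
      integrable_weilIntegrand (Complex.continuous_ofReal.comp b.continuous)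
        (b.hasCompactSupport.comp_left Complex.ofReal_zero) _
    have hre : ∀ t : ℝ, (((b t : ℝ) : ℂ) * cexp ((σ + γ * I - 1 / 2) * t)).re = F t := by
      intro t
      rw [Complex.re_ofReal_mul, Complex.exp_re]
      have h1 : ((σ + γ * I - 1 / 2) * (t : ℂ)).re = (σ - 1 / 2) * t := by
        simp [sub_re, add_re, mul_re]
      have h2 : ((σ + γ * I - 1 / 2) * (t : ℂ)).im = γ * t := by
        simp [sub_im, add_im, mul_im]
      rw [h1, h2, hF]
      ring
    intro h0
    have h0re : (weilMellin (fun t ↦ ((b t : ℝ) : ℂ)) (σ + γ * I)).re = 0 := by rw [h0]; rfl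
    unfold weilMellin at h0re
    have hI := integral_re hint
    simp only [RCLike.re_to_complex] at hI
    rw [← hI] at h0re
    simp_rw [hre] at h0re
    have hFc : Continuous F := by
      simp only [hF]
      have hb := b.continuous
      fun_prop
    have hFsupp : HasCompactSupport F := by
      simp only [hF]
      exact (b.hasCompactSupport.mul_right).mul_right
    have hFnn : 0 ≤ F := by
      intro t
      simp only [hF, Pi.zero_apply]
      by_cases ht : |t| < δ
      · refine mul_nonneg (mul_nonneg (b.nonneg' t) (Real.exp_pos _).le) (Real.cos_nonneg_of_mem_Icc ?_)
        have hγt : |γ * t| ≤ 1 := by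
          rw [abs_mul]
          calc |γ| * |t| ≤ |γ| * δ := mul_le_mul_of_nonneg_left ht.le (abs_nonneg _)
            _ ≤ |γ| * (1 / (1 + |γ|)) := mul_le_mul_of_nonneg_left hδγ (abs_nonneg _)
            _ = |γ| / (1 + |γ|) := by ring
            _ ≤ 1 := by rw [div_le_one (by positivity)]; linarith
        constructor <;> nlinarith [abs_le.1 hγt, Real.pi_gt_three]
      · have hb : b t = 0 := b.zero_of_le_dist (by simpa [Real.dist_eq] using not_lt.1 ht)
        simp [hb]
    have hF0 : F 0 ≠ 0 := by
      have hb0 : b 0 = 1 := b.one_of_mem_closedBall (by simp [b]; positivity)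
      simp [hF, hb0]
    exact (hFc.integral_pos_of_hasCompactSupport_nonneg_nonzero hFsupp hFnn hF0).ne' h0re

end Bump

section Primitive

variable {a : ℝ} {g : ℝ → ℂ}

/-- **The primitive `v(t) = e^{-wt} ∫_{-a}^t g(τ) e^{wτ} dτ`.** For a test function `g` on the
window `[-a, a]` with `∫ g(τ) e^{wτ} dτ = 0` it is again a test function on the window, and
`v' + w v = g`. (For `w = s₀ − 1/2` the hypothesis reads `ĝ(s₀) = 0`.) [folklore] -/
theorem exists_primitive (hg : IsWeilTest g) (hgs : tsupport g ⊆ Icc (-a) a) (w : ℂ)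
    (h0 : ∫ t, g t * cexp (w * t) = 0) :
    ∃ v : ℝ → ℂ, IsWeilTest v ∧ tsupport v ⊆ Icc (-a) a ∧ (∀ t, deriv v t + w * v t = g t) ∧
      ∀ t, v t = cexp (-(w * t)) * ∫ τ in (-a)..t, g τ * cexp (w * τ) := by
  set f : ℝ → ℂ := fun τ ↦ g τ * cexp (w * τ) with hf
  have hfs : ContDiff ℝ ∞ f := hg.1.mul (contDiff_const.mul Complex.ofRealCLM.contDiff).cexp
  have hfc : Continuous f := hfs.continuous
  set G : ℝ → ℂ := fun t ↦ ∫ τ in (-a)..t, f τ with hG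
  have hGd : ∀ t, HasDerivAt G (f t) t := fun t ↦ (hfc.integral_hasStrictDerivAt (-a) t).hasDerivAt
  have hGderiv : deriv G = f := funext fun t ↦ (hGd t).deriv
  have hGs : ContDiff ℝ ∞ G := by
    rw [contDiff_infty_iff_deriv, hGderiv]
    exact ⟨fun t ↦ (hGd t).differentiableAt, hfs⟩
  -- `g` vanishes off the open window
  have hg0 : ∀ x, x ∉ Ioo (-a) a → g x = 0 := fun x hx ↦
    Function.notMem_support.1 fun h ↦ hx (support_subset_Ioo_of_tsupport_subset_Icc hg.1.continuous hgs h)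
  have hf0 : ∀ x, x ∉ Ioo (-a) a → f x = 0 := fun x hx ↦ by simp [hf, hg0 x hx]
  -- `G` vanishes off the open window
  have hGa : G a = 0 := by
    have h1 : G a = ∫ τ, f τ := by
      simp only [hG]
      apply intervalIntegral.integral_eq_integral_of_support_subset
      intro x hx
      exact Ioo_subset_Ioc_self (by by_contra h'; exact hx (hf0 x h'))
    rw [h1]
    exact h0
  have hG0 : ∀ t, t ∉ Ioo (-a) a → G t = 0 := by
    intro t ht
    rw [mem_Ioo, not_and_or, not_lt, not_lt] at ht
    rcases ht with ht | ht
    · simp only [hG]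
      rw [intervalIntegral.integral_symm, neg_eq_zero]
      apply intervalIntegral.integral_zero_ae
      refine Eventually.of_forall fun x hx ↦ hf0 x ?_
      rw [uIoc_of_le ht] at hx
      exact fun h ↦ by linarith [hx.2, h.1]
    · have hsplit : G t = G a + ∫ τ in a..t, f τ := by
        simp only [hG]
        rw [intervalIntegral.integral_add_adjacent_intervals (hfc.intervalIntegrable _ _)
          (hfc.intervalIntegrable _ _)]
      rw [hsplit, hGa, zero_add]
      apply intervalIntegral.integral_zero_ae
      refine Eventually.of_forall fun x hx ↦ hf0 x ?_
      rw [uIoc_of_le ht] at hx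
      exact fun h ↦ by linarith [hx.1, h.2]
  set v : ℝ → ℂ := fun t ↦ cexp (-(w * t)) * G t with hv
  have hE : ∀ t : ℝ, HasDerivAt (fun t : ℝ ↦ cexp (-(w * t))) (-w * cexp (-(w * t))) t := by
    intro t
    have h1 : HasDerivAt (fun t : ℝ ↦ -(w * (t : ℂ))) (-(w * 1)) t :=
      ((Complex.ofRealCLM.hasDerivAt.const_mul w).congr_deriv (by simp)).neg
    convert (h1.cexp) using 1
    ring
  have hvd : ∀ t, HasDerivAt v (-w * v t + g t) t := by
    intro t
    have h := (hE t).mul (hGd t)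
    refine h.congr_deriv ?_
    have e1 : cexp (-(w * ↑t)) * cexp (w * ↑t) = 1 := by
      rw [← Complex.exp_add, neg_add_cancel, Complex.exp_zero]
    simp only [hv, hf]
    linear_combination (g t) * e1
  have hv0 : ∀ t, t ∉ Ioo (-a) a → v t = 0 := fun t ht ↦ by simp [hv, hG0 t ht]
  have hvsupp : Function.support v ⊆ Ioo (-a) a := fun t ht ↦ by
    by_contra h; exact ht (hv0 t h)
  have hvts : tsupport v ⊆ Icc (-a) a := by
    refine (closure_mono hvsupp).trans ?_
    rcases lt_or_ge (-a) a with h | h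
    · rw [closure_Ioo h.ne]
    · rw [Ioo_eq_empty (not_lt.2 h), closure_empty]; exact empty_subset _
  refine ⟨v, ⟨?_, ?_⟩, hvts, fun t ↦ ?_, fun t ↦ rfl⟩
  · exact ContDiff.mul (contDiff_const.mul Complex.ofRealCLM.contDiff).neg.cexp hGs
  · exact HasCompactSupport.of_support_subset_isCompact isCompact_Icc
      (hvsupp.trans Ioo_subset_Icc_self)
  · rw [(hvd t).deriv]
    ring

end Primitive

section ModifiedSequence

variable {a : ℝ} {u f : ℝ → ℂ}

/-- **`L²`-continuity of `f ↦ f̂(s)` on the window**: if `f ∈ L²` vanishes a.e. off `[-a, a]`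
then `‖f̂(s)‖ ≤ (∫_{[-a,a]} |e^{(s-1/2)t}|² dt)^{1/2} ‖f‖₂` (Cauchy–Schwarz on the window). [folklore] -/
theorem norm_weilMellin_le_of_ae_eq_zero (hf : MemLp f 2)
    (hfz : ∀ᵐ t, t ∉ Icc (-a) a → f t = 0) (s : ℂ) :
    ‖weilMellin f s‖ ≤
      √(∫ t in Icc (-a) a, ‖cexp ((s - 1 / 2) * t)‖ ^ 2) * √(∫ t, ‖f t‖ ^ 2) := by
  unfold weilMellin
  rw [← setIntegral_eq_integral_of_ae_compl_eq_zero (s := Icc (-a) a)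
    (hfz.mono fun t ht hts ↦ by simp [ht hts])]
  have hE : MemLp (fun t : ℝ ↦ cexp ((s - 1 / 2) * t)) 2 (volume.restrict (Icc (-a) a)) := by
    refine MemLp.of_bound (by fun_prop : Continuous fun t : ℝ ↦ cexp ((s - 1 / 2) * t)).aestronglyMeasurable
      (Real.exp (|(s - 1 / 2).re| * |a|)) ?_
    rw [ae_restrict_iff' measurableSet_Icc]
    refine Eventually.of_forall fun t ht ↦ ?_
    rw [Complex.norm_exp, Real.exp_le_exp]
    have h1 : ((s - 1 / 2) * (t : ℂ)).re = (s - 1 / 2).re * t := by simp [mul_re]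
    rw [h1]
    have ht' : |t| ≤ |a| := (abs_le.2 ⟨ht.1, ht.2⟩).trans (le_abs_self a)
    calc (s - 1 / 2).re * t ≤ |(s - 1 / 2).re * t| := le_abs_self _
      _ = |(s - 1 / 2).re| * |t| := abs_mul _ _
      _ ≤ |(s - 1 / 2).re| * |a| := mul_le_mul_of_nonneg_left ht' (abs_nonneg _)
  have h := norm_integral_mul_le_sqrt (hf.restrict (Icc (-a) a)) hE
  refine h.trans ?_
  rw [mul_comm]
  refine mul_le_mul_of_nonneg_left (Real.sqrt_le_sqrt ?_) (Real.sqrt_nonneg _)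
  exact setIntegral_le_integral ((memLp_two_iff_integrable_sq_norm hf.1).1 hf)
    (Eventually.of_forall fun t ↦ by positivity)

/-- **`ĝₘ(s) → û(s)` along an `L²`-convergent sequence of window test functions** (`u` a ground
state, so `u` vanishes a.e. off the window and `u(t)e^{ct}` is integrable). [folklore] -/
theorem tendsto_weilMellin (hu : IsWeilGroundState a u) {gs : ℕ → ℝ → ℂ}
    (hgs : ∀ m, IsWeilTest (gs m) ∧ tsupport (gs m) ⊆ Icc (-a) a)
    (hL2 : Tendsto (fun m ↦ ∫ t, ‖gs m t - u t‖ ^ 2) atTop (𝓝 0)) (s : ℂ) :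
    Tendsto (fun m ↦ weilMellin (gs m) s) atTop (𝓝 (weilMellin u s)) := by
  rw [tendsto_iff_norm_sub_tendsto_zero]
  set C := √(∫ t in Icc (-a) a, ‖cexp ((s - 1 / 2) * t)‖ ^ 2) with hC
  have hbound : ∀ m, ‖weilMellin (gs m) s - weilMellin u s‖ ≤ C * √(∫ t, ‖gs m t - u t‖ ^ 2) := by
    intro m
    have hsub : weilMellin (gs m) s - weilMellin u s = weilMellin (fun t ↦ gs m t - u t) s := by
      unfold weilMellin
      rw [← integral_sub (integrable_weilIntegrand (hgs m).1.1.continuous (hgs m).1.2 s)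
        (hu.integrable_mul_cexp (s - 1 / 2))]
      congr 1 with t
      ring
    rw [hsub]
    refine norm_weilMellin_le_of_ae_eq_zero ((isWeilTest_memLp (hgs m).1).sub hu.memLp) ?_ s
    filter_upwards [hu.ae_eq_zero_of_notMem] with t ht hts
    have h1 : gs m t = 0 := image_eq_zero_of_notMem_tsupport fun h' ↦ hts ((hgs m).2 h')
    simp [h1, ht hts]
  refine squeeze_zero (fun _ ↦ norm_nonneg _) hbound ?_
  have h := hL2.sqrt
  rw [Real.sqrt_zero] at h
  simpa using h.const_mul C

/-- **Killing the transform at `s₀` along the minimising sequence.** If `u` is a ground state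
with `û(s₀) = 0`, there are window test functions `g̃ₘ` with `g̃ₘ^(s₀) = 0`, `g̃ₘ → u` in `L²`
and energies `q(g̃ₘ) → 0`: subtract from the minimising sequence `gₘ` the multiple
`(ĝₘ(s₀)/ĥ(s₀)) h` of a fixed bump `h` with `ĥ(s₀) ≠ 0`; the coefficients tend to `û(s₀) = 0`.
[folklore] -/
theorem exists_modifiedSeq (hu : IsWeilGroundState a u) {s₀ : ℂ} (hs₀ : weilMellin u s₀ = 0) :
    ∃ gt : ℕ → ℝ → ℂ,
      (∀ m, IsWeilTest (gt m) ∧ tsupport (gt m) ⊆ Icc (-a) a ∧ weilMellin (gt m) s₀ = 0) ∧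
      Tendsto (fun m ↦ ∫ t, ‖gt m t - u t‖ ^ 2) atTop (𝓝 0) ∧
      Tendsto (fun m ↦ (weilQuadratic (gt m)).re - weilGroundEnergy a * ∫ t, ‖gt m t‖ ^ 2)
        atTop (𝓝 0) := by
  obtain ⟨huL, gs, hgs, hQ, hL2⟩ := id hu
  have ha : 0 < a := hu.pos
  obtain ⟨h, hh, hhs, hh0⟩ := exists_isWeilTest_weilMellin_ne_zero ha s₀
  set ε := weilGroundEnergy a with hε
  set β : ℕ → ℂ := fun m ↦ -weilMellin (gs m) s₀ / weilMellin h s₀ with hβdef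
  have hβ : Tendsto β atTop (𝓝 0) := by
    have h1 := tendsto_weilMellin hu (fun m ↦ ⟨(hgs m).1, (hgs m).2.1⟩) hL2 s₀
    rw [hs₀] at h1
    have h2 := (h1.neg).div_const (weilMellin h s₀)
    simpa using h2
  set gt : ℕ → ℝ → ℂ := fun m t ↦ gs m t + β m * h t with hgtdef
  have hgt : ∀ m, IsWeilTest (gt m) := fun m ↦ (hgs m).1.add (hh.const_mul (β m))
  have hgts : ∀ m, tsupport (gt m) ⊆ Icc (-a) a := fun m ↦
    (tsupport_add _ _).trans (union_subset (hgs m).2.1 (tsupport_mul_subset_right.trans hhs))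
  have hgt0 : ∀ m, weilMellin (gt m) s₀ = 0 := by
    intro m
    have e : gt m = gs m + fun t ↦ β m * h t := rfl
    rw [e, weilMellin_add (hgs m).1.1.continuous (hgs m).1.2 (hh.const_mul (β m)).1.continuous
      (hh.const_mul (β m)).2, weilMellin_const_mul]
    simp only [hβdef]
    field_simp
    ring
  refine ⟨gt, fun m ↦ ⟨hgt m, hgts m, hgt0 m⟩, ?_, ?_⟩
  · -- `L²` convergence by Minkowski
    have hhL := isWeilTest_memLp hh
    have hbound : ∀ m, √(∫ t, ‖gt m t - u t‖ ^ 2) ≤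
        √(∫ t, ‖gs m t - u t‖ ^ 2) + ‖β m‖ * √(∫ t, ‖h t‖ ^ 2) := by
      intro m
      have h1 := sqrt_integral_norm_sq_sub_le ((isWeilTest_memLp (hgs m).1).sub huL)
        ((hhL.const_mul (-β m)))
      have e1 : (fun t ↦ ‖gt m t - u t‖ ^ 2) = fun t ↦ ‖(gs m t - u t) - (-β m * h t)‖ ^ 2 := by
        funext t; simp only [hgtdef]; ring_nf
      have e2 : (∫ t, ‖-β m * h t‖ ^ 2) = ‖β m‖ ^ 2 * ∫ t, ‖h t‖ ^ 2 := by
        simp only [norm_mul, norm_neg, mul_pow]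
        rw [integral_const_mul]
      rw [e1]
      simp only [Pi.sub_apply] at h1
      rw [e2, Real.sqrt_mul (sq_nonneg _), Real.sqrt_sq (norm_nonneg _)] at h1
      exact h1
    have hlim : Tendsto (fun m ↦ √(∫ t, ‖gs m t - u t‖ ^ 2) + ‖β m‖ * √(∫ t, ‖h t‖ ^ 2))
        atTop (𝓝 0) := by
      have h1 := hL2.sqrt
      have h2 := (hβ.norm).mul_const (√(∫ t, ‖h t‖ ^ 2))
      rw [Real.sqrt_zero] at h1
      rw [norm_zero, zero_mul] at h2
      simpa using h1.add h2
    have hsqrt : Tendsto (fun m ↦ √(∫ t, ‖gt m t - u t‖ ^ 2)) atTop (𝓝 0) :=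
      squeeze_zero (fun _ ↦ Real.sqrt_nonneg _) hbound hlim
    have := hsqrt.pow 2
    rw [zero_pow two_ne_zero] at this
    refine this.congr fun m ↦ ?_
    exact Real.sq_sqrt (integral_nonneg fun _ ↦ by positivity)
  · -- energies by Cauchy–Schwarz
    set η : ℕ → ℝ := fun m ↦ (weilQuadratic (gs m)).re - ε * ∫ t, ‖gs m t‖ ^ 2 with hηdef
    have hη_eq : η = fun m ↦ (weilQuadratic (gs m)).re - ε := by
      funext m; simp only [hηdef, (hgs m).2.2, mul_one]
    have hηt : Tendsto η atTop (𝓝 0) := by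
      rw [hη_eq]
      have := hQ.sub_const ε
      simpa using this
    have hη0 : ∀ m, 0 ≤ η m := fun m ↦ by
      have := weilGroundEnergy_mul_le_re (hgs m).1 (hgs m).2.1
      simp only [hηdef]; linarith
    set qh := (weilQuadratic h).re - ε * ∫ t, ‖h t‖ ^ 2 with hqhdef
    have hlo : ∀ m, 0 ≤ (weilQuadratic (gt m)).re - ε * ∫ t, ‖gt m t‖ ^ 2 := fun m ↦ by
      have := weilGroundEnergy_mul_le_re (hgt m) (hgts m)
      linarith
    have hup : ∀ m, (weilQuadratic (gt m)).re - ε * ∫ t, ‖gt m t‖ ^ 2 ≤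
        (√(η m) + ‖β m‖ * √qh) ^ 2 := by
      intro m
      have h1 := shiftedForm_add_le (hgs m).1 (hgs m).2.1 (hh.const_mul (β m))
        (tsupport_mul_subset_right.trans hhs)
      rw [shiftedForm_const_mul, Real.sqrt_mul (sq_nonneg _), Real.sqrt_sq (norm_nonneg _)] at h1
      exact h1
    have hlim : Tendsto (fun m ↦ (√(η m) + ‖β m‖ * √qh) ^ 2) atTop (𝓝 0) := by
      have h1 := hηt.sqrt
      have h2 := (hβ.norm).mul_const (√qh)
      rw [Real.sqrt_zero] at h1
      rw [norm_zero, zero_mul] at h2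
      have := (h1.add h2).pow 2
      simpa using this
    exact tendsto_of_tendsto_of_tendsto_of_le_of_le tendsto_const_nhds hlim hlo hup

end ModifiedSequence

section L2Limits

variable {u F G : ℝ → ℂ} {f g : ℕ → ℝ → ℂ}

/-- `‖·‖₂` is continuous along an `L²`-convergent sequence: `∫|fₘ|² → ∫|F|²`. [folklore] -/
theorem tendsto_integral_norm_sq (hF : MemLp F 2) (hf : ∀ m, MemLp (f m) 2)
    (hlim : Tendsto (fun m ↦ ∫ t, ‖f m t - F t‖ ^ 2) atTop (𝓝 0)) :
    Tendsto (fun m ↦ ∫ t, ‖f m t‖ ^ 2) atTop (𝓝 (∫ t, ‖F t‖ ^ 2)) := by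
  have hsqrt : Tendsto (fun m ↦ √(∫ t, ‖f m t‖ ^ 2)) atTop (𝓝 (√(∫ t, ‖F t‖ ^ 2))) := by
    rw [tendsto_iff_norm_sub_tendsto_zero]
    have hb : ∀ m, ‖√(∫ t, ‖f m t‖ ^ 2) - √(∫ t, ‖F t‖ ^ 2)‖ ≤ √(∫ t, ‖f m t - F t‖ ^ 2) := by
      intro m
      rw [Real.norm_eq_abs, abs_sub_le_iff]
      constructor
      · have h1 := sqrt_integral_norm_sq_sub_le (hf m) ((hf m).sub hF)
        have e : (fun t ↦ ‖f m t - (f m - F) t‖ ^ 2) = fun t ↦ ‖F t‖ ^ 2 := by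
          funext t; simp
        simp only [Pi.sub_apply, sub_sub_cancel] at h1
        -- `√∫|f| ≤ √∫|F| + √∫|f - F|` from `f = F - (F - f)`
        have h2 := sqrt_integral_norm_sq_sub_le hF (hF.sub (hf m))
        simp only [Pi.sub_apply, sub_sub_cancel, norm_sub_rev (F _)] at h2
        linarith
      · have h2 := sqrt_integral_norm_sq_sub_le (hf m) ((hf m).sub hF)
        simp only [Pi.sub_apply, sub_sub_cancel] at h2
        linarith
    refine squeeze_zero (fun _ ↦ norm_nonneg _) hb ?_
    have h := hlim.sqrt
    rwa [Real.sqrt_zero] at h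
  have h := hsqrt.pow 2
  rw [Real.sq_sqrt (integral_nonneg fun _ ↦ by positivity)] at h
  refine h.congr fun m ↦ ?_
  exact Real.sq_sqrt (integral_nonneg fun _ ↦ by positivity)

/-- The pairing with a fixed `u ∈ L²` is continuous along an `L²`-convergent sequence:
`∫ fₘ ū → ∫ F ū`. [folklore] -/
theorem tendsto_integral_mul_conj_left (hu : MemLp u 2) (hF : MemLp F 2) (hf : ∀ m, MemLp (f m) 2)
    (hlim : Tendsto (fun m ↦ ∫ t, ‖f m t - F t‖ ^ 2) atTop (𝓝 0)) :
    Tendsto (fun m ↦ ∫ t, f m t * conj (u t)) atTop (𝓝 (∫ t, F t * conj (u t))) := by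
  rw [tendsto_iff_norm_sub_tendsto_zero]
  have hb : ∀ m, ‖(∫ t, f m t * conj (u t)) - ∫ t, F t * conj (u t)‖ ≤
      √(∫ t, ‖f m t - F t‖ ^ 2) * √(∫ t, ‖u t‖ ^ 2) := by
    intro m
    have hi1 : Integrable fun t ↦ f m t * conj (u t) := (hf m).integrable_mul (memLp_conj hu)
    have hi2 : Integrable fun t ↦ F t * conj (u t) := hF.integrable_mul (memLp_conj hu)
    rw [← integral_sub hi1 hi2]
    have e : (fun t ↦ f m t * conj (u t) - F t * conj (u t)) = fun t ↦ (f m t - F t) * conj (u t) := by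
      funext t; ring
    rw [e]
    have h := norm_integral_mul_le_sqrt ((hf m).sub hF) (memLp_conj hu)
    simp only [Pi.sub_apply, Complex.norm_conj] at h
    exact h
  refine squeeze_zero (fun _ ↦ norm_nonneg _) hb ?_
  have h := hlim.sqrt
  rw [Real.sqrt_zero] at h
  simpa using h.mul_const (√(∫ t, ‖u t‖ ^ 2))

/-- `L²`-convergence is stable under linear combinations: if `fₘ → F` and `gₘ → G` then
`fₘ + c gₘ → F + c G`. [folklore] -/
theorem tendsto_integral_norm_sq_add_mul (hF : MemLp F 2) (hf : ∀ m, MemLp (f m) 2)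
    (hG : MemLp G 2) (hg : ∀ m, MemLp (g m) 2) (c : ℂ)
    (hlf : Tendsto (fun m ↦ ∫ t, ‖f m t - F t‖ ^ 2) atTop (𝓝 0))
    (hlg : Tendsto (fun m ↦ ∫ t, ‖g m t - G t‖ ^ 2) atTop (𝓝 0)) :
    Tendsto (fun m ↦ ∫ t, ‖(f m t + c * g m t) - (F t + c * G t)‖ ^ 2) atTop (𝓝 0) := by
  have hb : ∀ m, √(∫ t, ‖(f m t + c * g m t) - (F t + c * G t)‖ ^ 2) ≤
      √(∫ t, ‖f m t - F t‖ ^ 2) + ‖c‖ * √(∫ t, ‖g m t - G t‖ ^ 2) := by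
    intro m
    have h1 := sqrt_integral_norm_sq_sub_le ((hf m).sub hF) (((hg m).sub hG).const_mul (-c))
    have e1 : (fun t ↦ ‖(f m t + c * g m t) - (F t + c * G t)‖ ^ 2) =
        fun t ↦ ‖(f m t - F t) - (-c * (g m t - G t))‖ ^ 2 := by
      funext t; ring_nf
    have e2 : (∫ t, ‖-c * (g m t - G t)‖ ^ 2) = ‖c‖ ^ 2 * ∫ t, ‖g m t - G t‖ ^ 2 := by
      simp only [norm_mul, norm_neg, mul_pow]
      rw [integral_const_mul]
    rw [e1]
    simp only [Pi.sub_apply] at h1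
    rw [e2, Real.sqrt_mul (sq_nonneg _), Real.sqrt_sq (norm_nonneg _)] at h1
    exact h1
  have hlim : Tendsto (fun m ↦ √(∫ t, ‖f m t - F t‖ ^ 2) + ‖c‖ * √(∫ t, ‖g m t - G t‖ ^ 2))
      atTop (𝓝 0) := by
    have h1 := hlf.sqrt
    have h2 := (hlg.sqrt).const_mul ‖c‖
    rw [Real.sqrt_zero] at h1 h2
    rw [mul_zero] at h2
    simpa using h1.add h2
  have hsqrt := squeeze_zero (fun _ ↦ Real.sqrt_nonneg _) hb hlim
  have := hsqrt.pow 2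
  rw [zero_pow two_ne_zero] at this
  refine this.congr fun m ↦ ?_
  exact Real.sq_sqrt (integral_nonneg fun _ ↦ by positivity)

end L2Limits

section PrimitiveLimit

variable {a : ℝ} {u : ℝ → ℂ}

/-- **The primitives converge.** Along window test functions `g̃ₘ → u` in `L²` (`u` a ground
state), the primitives `vₘ(t) = e^{-wt}∫_{-a}^t g̃ₘ e^{wτ}` (supported in the window) converge in
`L²` to the window-truncated primitive `V(t) = 1_{[-a,a]}(t) e^{-wt}∫_{-a}^t u e^{wτ}`
(uniformly on the window, by Cauchy–Schwarz on `[-a, a]`). [folklore] -/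
theorem tendsto_primitive (hu : IsWeilGroundState a u) {gt : ℕ → ℝ → ℂ}
    (hgt : ∀ m, IsWeilTest (gt m) ∧ tsupport (gt m) ⊆ Icc (-a) a)
    (hL2 : Tendsto (fun m ↦ ∫ t, ‖gt m t - u t‖ ^ 2) atTop (𝓝 0)) (w : ℂ) {v : ℕ → ℝ → ℂ}
    (hv : ∀ m t, v m t = cexp (-(w * t)) * ∫ τ in (-a)..t, gt m τ * cexp (w * τ))
    (hvs : ∀ m, tsupport (v m) ⊆ Icc (-a) a) :
    Tendsto (fun m ↦ ∫ t, ‖v m t - (Icc (-a) a).indicator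
      (fun t ↦ cexp (-(w * t)) * ∫ τ in (-a)..t, u τ * cexp (w * τ)) t‖ ^ 2) atTop (𝓝 0) := by
  have ha : 0 < a := hu.pos
  set C : ℝ := Real.exp (|w.re| * a) with hC
  have hCpos : 0 < C := Real.exp_pos _
  have hexp : ∀ z : ℂ, ∀ t ∈ Icc (-a) a, z = w ∨ z = -w → ‖cexp (z * t)‖ ≤ C := by
    intro z t ht hz
    rw [Complex.norm_exp, hC, Real.exp_le_exp]
    have h1 : (z * (t : ℂ)).re = z.re * t := by simp [mul_re]
    rw [h1]
    have hzre : |z.re| = |w.re| := by rcases hz with rfl | rfl <;> simp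
    have ht' : |t| ≤ a := abs_le.2 ⟨ht.1, ht.2⟩
    calc z.re * t ≤ |z.re * t| := le_abs_self _
      _ = |w.re| * |t| := by rw [abs_mul, hzre]
      _ ≤ |w.re| * a := mul_le_mul_of_nonneg_left ht' (abs_nonneg _)
  set D : ℕ → ℝ := fun m ↦ ∫ t, ‖gt m t - u t‖ ^ 2 with hD
  set V : ℝ → ℂ := (Icc (-a) a).indicator
    (fun t ↦ cexp (-(w * t)) * ∫ τ in (-a)..t, u τ * cexp (w * τ)) with hV
  -- Cauchy–Schwarz on the window
  have hI : ∀ m, ∫ τ in Icc (-a) a, ‖gt m τ - u τ‖ ≤ √(2 * a) * √(D m) := by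
    intro m
    have hA : MemLp (fun τ ↦ gt m τ - u τ) 2 (volume.restrict (Icc (-a) a)) :=
      (((isWeilTest_memLp (hgt m).1).sub hu.memLp).restrict (Icc (-a) a))
    have hB : MemLp (fun _ : ℝ ↦ (1 : ℂ)) 2 (volume.restrict (Icc (-a) a)) := memLp_const 1
    have h := integral_norm_mul_norm_le_sqrt hA hB
    simp only [norm_one, mul_one, one_pow, integral_const, MeasurableSet.univ,
      measureReal_restrict_apply, univ_inter, smul_eq_mul, Real.volume_real_Icc_of_le
        (by linarith : -a ≤ a)] at h
    rw [show a - -a = 2 * a by ring, mul_comm] at h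
    refine h.trans (mul_le_mul_of_nonneg_left (Real.sqrt_le_sqrt ?_) (Real.sqrt_nonneg _))
    have hL : MemLp (fun τ ↦ gt m τ - u τ) 2 := (isWeilTest_memLp (hgt m).1).sub hu.memLp
    have hint : Integrable (fun τ ↦ ‖gt m τ - u τ‖ ^ 2) :=
      (memLp_two_iff_integrable_sq_norm hL.1).1 hL
    exact setIntegral_le_integral hint (Eventually.of_forall fun t ↦ by positivity)
  -- uniform bound on the window
  have key : ∀ m, ∀ t ∈ Icc (-a) a, ‖v m t - V t‖ ≤ C * (C * (√(2 * a) * √(D m))) := by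
    intro m t ht
    have hdi : Integrable (fun τ ↦ gt m τ - u τ) :=
      ((hgt m).1.1.continuous.integrable_of_hasCompactSupport (hgt m).1.2).sub hu.integrable
    have hVt : V t = cexp (-(w * t)) * ∫ τ in (-a)..t, u τ * cexp (w * τ) := by
      simp [hV, indicator_of_mem ht]
    have hgi : IntervalIntegrable (fun τ ↦ gt m τ * cexp (w * τ)) volume (-a) t :=
      ((hgt m).1.1.continuous.mul (by fun_prop)).intervalIntegrable _ _
    have hui : IntervalIntegrable (fun τ ↦ u τ * cexp (w * τ)) volume (-a) t :=
      (hu.integrable_mul_cexp w).intervalIntegrable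
    rw [hv m t, hVt, ← mul_sub, ← intervalIntegral.integral_sub hgi hui, norm_mul,
      show -(w * (t : ℂ)) = -w * t by ring]
    refine mul_le_mul (hexp (-w) t ht (Or.inr rfl)) ?_ (norm_nonneg _) hCpos.le
    have hat : -a ≤ t := ht.1
    calc ‖∫ τ in (-a)..t, (gt m τ * cexp (w * τ) - u τ * cexp (w * τ))‖
        ≤ ∫ τ in (-a)..t, ‖gt m τ * cexp (w * τ) - u τ * cexp (w * τ)‖ :=
          intervalIntegral.norm_integral_le_integral_norm hat
      _ ≤ ∫ τ in (-a)..t, C * ‖gt m τ - u τ‖ := by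
          refine intervalIntegral.integral_mono_on hat (hgi.sub hui).norm
            ((hdi.norm.const_mul C).intervalIntegrable) fun τ hτ ↦ ?_
          · have hτ' : τ ∈ Icc (-a) a := ⟨hτ.1, hτ.2.trans ht.2⟩
            rw [← sub_mul, norm_mul, mul_comm]
            exact mul_le_mul_of_nonneg_right (hexp w τ hτ' (Or.inl rfl)) (norm_nonneg _)
      _ = C * ∫ τ in (-a)..t, ‖gt m τ - u τ‖ := intervalIntegral.integral_const_mul _ _
      _ ≤ C * ∫ τ in Icc (-a) a, ‖gt m τ - u τ‖ := by
          refine mul_le_mul_of_nonneg_left ?_ hCpos.le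
          rw [intervalIntegral.integral_of_le hat]
          refine setIntegral_mono_set ?_ (Eventually.of_forall fun _ ↦ norm_nonneg _)
            (Eventually.of_forall (Ioc_subset_Icc_self.trans (Icc_subset_Icc le_rfl ht.2)))
          exact hdi.norm.integrableOn
      _ ≤ C * (√(2 * a) * √(D m)) := mul_le_mul_of_nonneg_left (hI m) hCpos.le
  -- integrate the square of the bound over the window
  have hzero : ∀ m t, t ∉ Icc (-a) a → ‖v m t - V t‖ ^ 2 = 0 := by
    intro m t ht
    have h1 : v m t = 0 := image_eq_zero_of_notMem_tsupport fun h ↦ ht (hvs m h)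
    simp [h1, hV, indicator_of_notMem ht]
  have hbound : ∀ m, ∫ t, ‖v m t - V t‖ ^ 2 ≤ (C * (C * (√(2 * a) * √(D m)))) ^ 2 * (2 * a) := by
    intro m
    rw [← setIntegral_eq_integral_of_forall_compl_eq_zero (hzero m)]
    have h := norm_setIntegral_le_of_norm_le_const (μ := volume) (s := Icc (-a) a)
      (f := fun t ↦ ‖v m t - V t‖ ^ 2) (C := (C * (C * (√(2 * a) * √(D m)))) ^ 2)
      measure_Icc_lt_top fun t ht ↦ ?_
    · rw [Real.volume_real_Icc_of_le (by linarith : -a ≤ a), show a - -a = 2 * a by ring] at h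
      exact (Real.le_norm_self _).trans h
    · rw [Real.norm_eq_abs, abs_of_nonneg (by positivity)]
      exact pow_le_pow_left₀ (norm_nonneg _) (key m t ht) 2
  have hlim : Tendsto (fun m ↦ (C * (C * (√(2 * a) * √(D m)))) ^ 2 * (2 * a)) atTop (𝓝 0) := by
    have h := ((((hL2.sqrt).const_mul (√(2 * a))).const_mul C).const_mul C).pow 2 |>.mul_const (2 * a)
    rw [Real.sqrt_zero] at h
    simpa using h
  exact tendsto_of_tendsto_of_tendsto_of_le_of_le tendsto_const_nhds hlim
    (fun m ↦ integral_nonneg fun _ ↦ by positivity) hbound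

end PrimitiveLimit

/-! ## §D. Translation invariance: `Q(v' − c v) = Q(v' + c̄ v)`

`Q(g) = W(g ⋆ g̃)` only sees the kernel `g ⋆ g̃`, and for a test function `v` the kernels of
`v' − c v` and of `v' + c̄ v` coincide as functions, because `v' ⋆ ṽ = (v ⋆ ṽ)' = −v ⋆ (v')̃`
(`d/dt` is skew for the translation-invariant pairing). This is the continuum form of the
commutation relation `[D, Q] = |β⟩⟨η| − |η⟩⟨β|` (Connes–van Suijlekom 2025, Lemma 5.1 (5.2)):
on functions vanishing at the ends of the window the boundary term `|β⟩⟨η| − |η⟩⟨β|` is absent. -/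

section Translation

variable {v w : ℝ → ℂ}

/-- `(v')̃ = −(ṽ)'`: the involution anticommutes with `d/dt`. [folklore] -/
theorem weilReflect_deriv (v : ℝ → ℂ) :
    weilReflect (deriv v) = fun t ↦ -deriv (weilReflect v) t := by
  funext t
  have h1 : weilReflect v = fun s ↦ star ((fun r ↦ v (-r)) s) := by
    funext s; simp [weilReflect]
  rw [h1, deriv.star, deriv_comp_neg]
  simp [weilReflect]

/-- `(v ⋆ w)' = v' ⋆ w` for a test function `v` and a continuous `w`
(`HasCompactSupport.hasDerivAt_convolution_left`). [folklore] -/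
theorem deriv_weilConv_left (hv : IsWeilTest v) (hw : Continuous w) :
    deriv (weilConv v w) = weilConv (deriv v) w := by
  funext t
  rw [weilConv_eq_convolution_real, weilConv_eq_convolution_real]
  exact (hv.2.hasDerivAt_convolution_left (ContinuousLinearMap.mul ℝ ℂ)
    (hv.1.of_le (by norm_cast)) hw.locallyIntegrable t).deriv

/-- `(v ⋆ w)' = v ⋆ w'` for a continuous `v` and a test function `w`
(`HasCompactSupport.hasDerivAt_convolution_right`). [folklore] -/
theorem deriv_weilConv_right (hv : Continuous v) (hw : IsWeilTest w) :
    deriv (weilConv v w) = weilConv v (deriv w) := by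
  funext t
  rw [weilConv_eq_convolution_real, weilConv_eq_convolution_real]
  exact (hw.2.hasDerivAt_convolution_right (ContinuousLinearMap.mul ℝ ℂ)
    hv.locallyIntegrable (hw.1.of_le (by norm_cast)) t).deriv

/-- **The kernel of `v' + α v`.** For a test function `v` and `α : ℂ`,
`(v' + αv) ⋆ (v' + αv)̃ = v' ⋆ (v')̃ + (ᾱ − α)·(v ⋆ ṽ)' + |α|²·(v ⋆ ṽ)`,
using `v' ⋆ ṽ = (v ⋆ ṽ)'` and `v ⋆ (v')̃ = −(v ⋆ ṽ)'`. [folklore] -/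
theorem weilConv_weilReflect_deriv_add_mul (hv : IsWeilTest v) (α : ℂ) :
    weilConv (fun t ↦ deriv v t + α * v t) (weilReflect fun t ↦ deriv v t + α * v t) =
      fun t ↦ weilConv (deriv v) (weilReflect (deriv v)) t +
        (conj α - α) * deriv (weilConv v (weilReflect v)) t +
        (Complex.normSq α : ℂ) * weilConv v (weilReflect v) t := by
  have hv' : IsWeilTest (deriv v) := hv.deriv
  have hαv : IsWeilTest fun t ↦ α * v t := hv.const_mul α
  have hsum : (fun t ↦ deriv v t + α * v t) = deriv v + fun t ↦ α * v t := by
    funext t; simp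
  have hB : weilConv (deriv v) (weilReflect v) = deriv (weilConv v (weilReflect v)) :=
    (deriv_weilConv_left hv hv.weilReflect.1.continuous).symm
  have hB' : weilConv v (weilReflect (deriv v)) =
      fun t ↦ -deriv (weilConv v (weilReflect v)) t := by
    rw [weilReflect_deriv, show (fun t ↦ -deriv (weilReflect v) t) =
      fun t ↦ (-1 : ℂ) * deriv (weilReflect v) t from funext fun t ↦ by ring,
      weilConv_const_mul_right, ← deriv_weilConv_right hv.1.continuous hv.weilReflect]
    funext t; ring
  rw [hsum, weilReflect_add, weilConv_add_left hv' hαv (hv'.weilReflect.add hαv.weilReflect),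
    weilConv_add_right hv' hv'.weilReflect hαv.weilReflect,
    weilConv_add_right hαv hv'.weilReflect hαv.weilReflect, weilReflect_const_mul,
    weilConv_const_mul_right, weilConv_const_mul_right, weilConv_const_mul_left,
    weilConv_const_mul_left, hB, hB']
  funext t
  simp only [Pi.add_apply, Complex.normSq_eq_conj_mul_self]
  ring

/-- **Translation identity.** For a test function `v` and `c : ℂ` the kernels of `v' − c v`
and of `v' + c̄ v` coincide: `(v' − cv) ⋆ (v' − cv)̃ = (v' + c̄v) ⋆ (v' + c̄v)̃`.
(Continuum form of Connes–van Suijlekom 2025, Lemma 5.1 (5.2), without boundary term.)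
[cite: ConnesSuijlekom2025, Lemma 5.1 (5.2)] -/
theorem weilConv_weilReflect_deriv_sub_eq (hv : IsWeilTest v) (c : ℂ) :
    weilConv (fun t ↦ deriv v t + -c * v t) (weilReflect fun t ↦ deriv v t + -c * v t) =
      weilConv (fun t ↦ deriv v t + conj c * v t) (weilReflect fun t ↦ deriv v t + conj c * v t) := by
  rw [weilConv_weilReflect_deriv_add_mul hv, weilConv_weilReflect_deriv_add_mul hv]
  funext t
  simp only [map_neg, Complex.conj_conj, Complex.normSq_neg, Complex.normSq_conj]
  ring

/-- `Q(v' − c v) = Q(v' + c̄ v)` for every test function `v` and `c : ℂ`.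
[cite: ConnesSuijlekom2025, Lemma 5.1 (5.2)] -/
theorem weilQuadratic_deriv_sub_eq (hv : IsWeilTest v) (c : ℂ) :
    weilQuadratic (fun t ↦ deriv v t + -c * v t) =
      weilQuadratic (fun t ↦ deriv v t + conj c * v t) := by
  unfold weilQuadratic
  rw [weilConv_weilReflect_deriv_sub_eq hv c]

/-- `‖v' − c v‖₂ = ‖v' + c̄ v‖₂` for every test function `v` and `c : ℂ`
(evaluate the common kernel at `0`: `(g ⋆ g̃)(0) = ∫|g|²`). [folklore] -/
theorem integral_norm_sq_deriv_sub_eq (hv : IsWeilTest v) (c : ℂ) :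
    ∫ t, ‖deriv v t + -c * v t‖ ^ 2 = ∫ t, ‖deriv v t + conj c * v t‖ ^ 2 := by
  have h := congr_fun (weilConv_weilReflect_deriv_sub_eq hv c) 0
  rw [weilConv_weilReflect_apply_zero, weilConv_weilReflect_apply_zero] at h
  exact_mod_cast h

end Translation

/-! ## §E. Assembly: a zero off the critical line forces `u = 0` -/

section Analysis

/-- **Vanishing of all interval integrals forces a.e. vanishing** (Lebesgue differentiation:
averages over the balls `[x − r, x + r]` tend to `f x` a.e.). [folklore] -/
theorem ae_eq_zero_of_forall_intervalIntegral_eq_zero {f : ℝ → ℂ} (hf : Integrable f)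
    (h : ∀ s t : ℝ, s ≤ t → ∫ x in s..t, f x = 0) : f =ᵐ[volume] 0 := by
  have key := IsUnifLocDoublingMeasure.ae_tendsto_average (μ := volume) hf.locallyIntegrable 1
  filter_upwards [key] with x hx
  have h1 : Tendsto (fun r : ℝ ↦ ⨍ y in Metric.closedBall x r, f y) (𝓝[>] 0) (𝓝 (f x)) :=
    hx (fun _ ↦ x) id tendsto_id (by
      filter_upwards [self_mem_nhdsWithin] with r (hr : 0 < r)
      rw [one_mul]; exact Metric.mem_closedBall_self hr.le)
  have h2 : Tendsto (fun r : ℝ ↦ ⨍ y in Metric.closedBall x r, f y) (𝓝[>] 0) (𝓝 0) := by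
    refine tendsto_const_nhds.congr' ?_
    filter_upwards [self_mem_nhdsWithin] with r (hr : 0 < r)
    rw [Real.closedBall_eq_Icc, setAverage_eq, integral_Icc_eq_integral_Ioc,
      ← intervalIntegral.integral_of_le (by linarith), h (x - r) (x + r) (by linarith), smul_zero]
  exact tendsto_nhds_unique h1 h2

/-- **The integral equation `F = κ ∫ F` has only the zero solution** (Gronwall). [folklore] -/
theorem eq_zero_of_eq_mul_intervalIntegral {F : ℝ → ℂ} (hF : Continuous F) (κ : ℂ) {a b : ℝ}
    (h : ∀ t ∈ Icc a b, F t = κ * ∫ τ in a..t, F τ) : ∀ t ∈ Icc a b, F t = 0 := by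
  set Φ : ℝ → ℂ := fun t ↦ ∫ τ in a..t, F τ with hΦ
  have hΦd : ∀ t, HasDerivAt Φ (F t) t := fun t ↦ (hF.integral_hasStrictDerivAt a t).hasDerivAt
  have hΦc : Continuous Φ := continuous_iff_continuousAt.2 fun t ↦ (hΦd t).continuousAt
  have hgr := norm_le_gronwallBound_of_norm_deriv_right_le (f := Φ) (f' := F) (δ := 0) (K := ‖κ‖)
    (ε := 0) (a := a) (b := b) hΦc.continuousOn (fun t _ ↦ (hΦd t).hasDerivWithinAt)
    (by simp [hΦ]) (fun t ht ↦ by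
      rw [h t (Ico_subset_Icc_self ht), norm_mul, add_zero])
  intro t ht
  have h0 : Φ t = 0 := by
    have := hgr t ht
    rw [gronwallBound_ε0_δ0] at this
    exact norm_le_zero_iff.1 this
  rw [h t ht]
  change κ * Φ t = 0
  rw [h0, mul_zero]

end Analysis

section Main

variable {a : ℝ} {u : ℝ → ℂ}

/-- **No zeros off the critical line.** Under `WeilWindowSimpleEven a`, the transform
`û = weilMellin u` of a ground state `u` does not vanish at any `s₀` with `Re s₀ ≠ 1/2`.

Proof (direct variational form of Connes–van Suijlekom 2025, Thm. 6.1): write `w = s₀ − 1/2`,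
`x = Re w ≠ 0`, and suppose `û(s₀) = 0`. Along window test functions `g̃ₘ → u` with
`g̃ₘ^(s₀) = 0` and energies `q(g̃ₘ) → 0` (`exists_modifiedSeq`), factor `g̃ₘ = vₘ' + w vₘ`
(`exists_primitive`). By translation invariance (`weilQuadratic_deriv_sub_eq`) the test functions
`kₘ = vₘ' − w̄ vₘ = g̃ₘ − 2x vₘ` have the same energies and norms, so by the gap lemma
(`gap_inequality`) their distance to `ℂ u` tends to `0`; passing to the limit, `u − 2x V ∈ ℂ u`
with `V(t) = e^{-wt}∫_{-a}^t u e^{wτ}` on the window, i.e. `V = κ u` a.e. If `κ ≠ 0` the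
continuous `F(t) = ∫_{-a}^t u e^{wτ}` solves `F = κ⁻¹ ∫ F`, so `F ≡ 0` (Gronwall); if `κ = 0`
then `F ≡ 0` directly; either way all interval integrals of `u e^{wτ}` vanish and `u = 0` a.e.
(Lebesgue differentiation), contradicting `‖u‖₂ = 1`.
[cite: ConnesSuijlekom2025, Thm. 6.1] -/
theorem weilMellin_ne_zero_of_re_ne_half (hW : WeilWindowSimpleEven a) (hu : IsWeilGroundState a u)
    {s₀ : ℂ} (hs : s₀.re ≠ 1 / 2) : weilMellin u s₀ ≠ 0 := by
  intro hs₀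
  have ha : 0 < a := hu.pos
  have huL : MemLp u 2 := hu.memLp
  have hu1 : ∫ t, ‖u t‖ ^ 2 = 1 := hu.integral_norm_sq
  obtain ⟨δ, hδ, hgap⟩ := gap_inequality hW hu
  set w : ℂ := s₀ - 1 / 2 with hw
  set x : ℝ := w.re with hx
  have hx0 : x ≠ 0 := by
    simp only [hx, hw, Complex.sub_re, Complex.div_ofNat_re, Complex.one_re]
    exact sub_ne_zero.2 hs
  -- the modified minimising sequence and its primitives
  obtain ⟨gt, hgt, hL2, hq⟩ := exists_modifiedSeq hu hs₀
  have h0 : ∀ m, ∫ t, gt m t * cexp (w * t) = 0 := fun m ↦ by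
    have := (hgt m).2.2
    unfold weilMellin at this
    exact this
  choose v hv using fun m ↦ exists_primitive (hgt m).1 (hgt m).2.1 w (h0 m)
  -- `k m = v' - conj w v = gt m - 2x v m`
  set k : ℕ → ℝ → ℂ := fun m t ↦ deriv (v m) t + conj (-w) * v m t with hkdef
  have hk_test : ∀ m, IsWeilTest (k m) := fun m ↦ (hv m).1.deriv.add ((hv m).1.const_mul _)
  have hk_supp : ∀ m, tsupport (k m) ⊆ Icc (-a) a := fun m ↦
    (tsupport_add _ _).trans (union_subset (tsupport_deriv_subset.trans (hv m).2.1)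
      (tsupport_mul_subset_right.trans (hv m).2.1))
  have hgt_eq : ∀ m, (fun t ↦ deriv (v m) t + -(-w) * v m t) = gt m := fun m ↦
    funext fun t ↦ by rw [neg_neg]; exact (hv m).2.2.1 t
  have hQk : ∀ m, weilQuadratic (k m) = weilQuadratic (gt m) := fun m ↦ by
    rw [← hgt_eq m, weilQuadratic_deriv_sub_eq (hv m).1 (-w)]
  have hNk : ∀ m, ∫ t, ‖k m t‖ ^ 2 = ∫ t, ‖gt m t‖ ^ 2 := fun m ↦ by
    have := integral_norm_sq_deriv_sub_eq (hv m).1 (-w)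
    rw [← hgt_eq m]
    exact this.symm
  have hwc : w + conj w = ((2 * x : ℝ) : ℂ) := by rw [Complex.add_conj]
  have hk_eq : ∀ m t, k m t = gt m t + ((-(2 * x) : ℝ) : ℂ) * v m t := by
    intro m t
    have h1 := (hv m).2.2.1 t
    simp only [hkdef, map_neg]
    push_cast at hwc ⊢
    linear_combination h1 - (v m t) * hwc
  -- the gap inequality along `k m`
  set D : ℕ → ℝ := fun m ↦ (∫ t, ‖k m t‖ ^ 2) - ‖∫ t, k m t * conj (u t)‖ ^ 2 with hDdef
  have hD_le : ∀ m, D m ≤ ((weilQuadratic (gt m)).re - weilGroundEnergy a * ∫ t, ‖gt m t‖ ^ 2) / δ := by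
    intro m
    rw [le_div_iff₀ hδ, mul_comm]
    have := hgap (k m) (hk_test m) (hk_supp m)
    rw [hQk m, hNk m] at this
    simpa only [hDdef, hNk m] using this
  have hD_ge : ∀ m, 0 ≤ D m := by
    intro m
    have hcs := norm_integral_mul_le_sqrt (isWeilTest_memLp (hk_test m)) (memLp_conj huL)
    simp only [Complex.norm_conj] at hcs
    rw [hu1, Real.sqrt_one, mul_one] at hcs
    have := pow_le_pow_left₀ (norm_nonneg _) hcs 2
    rw [Real.sq_sqrt (integral_nonneg fun _ ↦ by positivity)] at this
    simp only [hDdef]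
    linarith
  have hD0 : Tendsto D atTop (𝓝 0) :=
    tendsto_of_tendsto_of_tendsto_of_le_of_le tendsto_const_nhds
      (by simpa using hq.div_const δ) hD_ge hD_le
  -- `L²` limits: `v m → V`, `k m → K = u - 2x V`
  set F : ℝ → ℂ := fun t ↦ ∫ τ in (-a)..t, u τ * cexp (w * τ) with hFdef
  have hFc : Continuous F :=
    intervalIntegral.continuous_primitive (fun _ _ ↦ (hu.integrable_mul_cexp w).intervalIntegrable) (-a)
  set G : ℝ → ℂ := fun t ↦ cexp (-(w * t)) * F t with hGdef
  have hGc : Continuous G := by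
    simp only [hGdef]
    exact (by fun_prop : Continuous fun t : ℝ ↦ cexp (-(w * t))).mul hFc
  set V : ℝ → ℂ := (Icc (-a) a).indicator G with hVdef
  have hVL : MemLp V 2 := by
    rw [hVdef, memLp_indicator_iff_restrict measurableSet_Icc]
    obtain ⟨B, hB⟩ := isCompact_Icc.exists_bound_of_continuousOn hGc.continuousOn
    exact MemLp.of_bound hGc.aestronglyMeasurable B
      ((ae_restrict_iff' measurableSet_Icc).2 (Eventually.of_forall hB))
  have hvL2 : Tendsto (fun m ↦ ∫ t, ‖v m t - V t‖ ^ 2) atTop (𝓝 0) :=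
    tendsto_primitive hu (fun m ↦ ⟨(hgt m).1, (hgt m).2.1⟩) hL2 w (fun m t ↦ (hv m).2.2.2 t)
      (fun m ↦ (hv m).2.1)
  set K : ℝ → ℂ := fun t ↦ u t + ((-(2 * x) : ℝ) : ℂ) * V t with hKdef
  have hKL : MemLp K 2 := huL.add (hVL.const_mul _)
  have hkL2 : Tendsto (fun m ↦ ∫ t, ‖k m t - K t‖ ^ 2) atTop (𝓝 0) := by
    have h := tendsto_integral_norm_sq_add_mul huL (fun m ↦ isWeilTest_memLp (hgt m).1) hVL
      (fun m ↦ isWeilTest_memLp (hv m).1) ((-(2 * x) : ℝ) : ℂ) hL2 hvL2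
    refine h.congr fun m ↦ ?_
    congr 1 with t
    rw [hk_eq m t]
  have hNlim : Tendsto (fun m ↦ ∫ t, ‖k m t‖ ^ 2) atTop (𝓝 (∫ t, ‖K t‖ ^ 2)) :=
    tendsto_integral_norm_sq hKL (fun m ↦ isWeilTest_memLp (hk_test m)) hkL2
  have hPlim : Tendsto (fun m ↦ ∫ t, k m t * conj (u t)) atTop (𝓝 (∫ t, K t * conj (u t))) :=
    tendsto_integral_mul_conj_left huL hKL (fun m ↦ isWeilTest_memLp (hk_test m)) hkL2
  set cK := ∫ t, K t * conj (u t) with hcKdef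
  have hDlim : Tendsto D atTop (𝓝 ((∫ t, ‖K t‖ ^ 2) - ‖cK‖ ^ 2)) := hNlim.sub ((hPlim.norm).pow 2)
  have hL0 : (∫ t, ‖K t‖ ^ 2) - ‖cK‖ ^ 2 = 0 := tendsto_nhds_unique hDlim hD0
  -- `K = cK u` a.e., i.e. `V = κ u` a.e.
  have hKae : ∀ᵐ t, K t + -cK * u t = 0 := by
    have h1 : ∫ t, ‖K t + -cK * u t‖ ^ 2 = 0 := by
      rw [integral_norm_sq_sub_proj hKL huL hu1]
      exact hL0
    have hint : Integrable fun t ↦ ‖K t + -cK * u t‖ ^ 2 := by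
      have hm : MemLp (fun t ↦ K t + -cK * u t) 2 := hKL.add (huL.const_mul _)
      exact (memLp_two_iff_integrable_sq_norm hm.1).1 hm
    have h2 := (integral_eq_zero_iff_of_nonneg (fun t ↦ by positivity) hint).1 h1
    filter_upwards [h2] with t ht
    simpa using ht
  set κ : ℂ := (1 - cK) / ((2 * x : ℝ) : ℂ) with hκdef
  have h2x : ((2 * x : ℝ) : ℂ) ≠ 0 := by exact_mod_cast (mul_ne_zero two_ne_zero hx0)
  have hVu : ∀ᵐ t, V t = κ * u t := by
    filter_upwards [hKae] with t ht
    simp only [hKdef] at ht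
    rw [hκdef, div_mul_eq_mul_div, eq_div_iff h2x]
    push_cast at ht ⊢
    linear_combination -ht
  -- `u` vanishes a.e. off the open window (the end points are null)
  have hu_off : ∀ᵐ t, t ∉ Ioo (-a) a → u t = 0 := by
    have h1 : ∀ᵐ t : ℝ, t ≠ -a ∧ t ≠ a := by
      have : volume ({-a, a} : Set ℝ) = 0 := by
        rw [Set.insert_eq]
        exact measure_union_null Real.volume_singleton Real.volume_singleton
      filter_upwards [measure_eq_zero_iff_ae_notMem.1 this] with t ht
      simpa [not_or] using ht
    filter_upwards [hu.ae_eq_zero_of_notMem, h1] with t ht h1t hto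
    refine ht fun hc ↦ hto ⟨lt_of_le_of_ne hc.1 (Ne.symm h1t.1), lt_of_le_of_ne hc.2 h1t.2⟩
  -- in both cases `F ≡ 0` on the window
  have hF_zero : ∀ t ∈ Icc (-a) a, F t = 0 := by
    by_cases hκ : κ = 0
    · -- `V = 0` a.e.: `G = 0` on the open window by continuity, then on the closed window
      have hG0 : EqOn G 0 (Ioo (-a) a) := by
        refine Measure.eqOn_open_of_ae_eq (μ := volume) ?_ isOpen_Ioo hGc.continuousOn continuousOn_const
        rw [EventuallyEq, ae_restrict_iff' measurableSet_Ioo]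
        filter_upwards [hVu] with t ht hto
        have : V t = G t := by simp [hVdef, indicator_of_mem (Ioo_subset_Icc_self hto)]
        rw [← this, ht, hκ, zero_mul, Pi.zero_apply]
      have hF0 : EqOn F 0 (Ioo (-a) a) := fun t ht ↦ by
        have := hG0 ht
        simp only [hGdef, Pi.zero_apply, mul_eq_zero, Complex.exp_ne_zero, false_or] at this
        exact this
      have hcl : Icc (-a) a ⊆ {t | F t = 0} := by
        rw [← closure_Ioo (by linarith : (-a) ≠ a)]
        exact closure_minimal hF0 (isClosed_eq hFc continuous_const)
      exact fun t ht ↦ hcl ht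
    · -- `u = κ⁻¹ V` a.e.: `F = κ⁻¹ ∫ F` on the window, so `F ≡ 0` by Gronwall
      refine eq_zero_of_eq_mul_intervalIntegral hFc κ⁻¹ fun t ht ↦ ?_
      have hat : -a ≤ t := ht.1
      calc F t = ∫ τ in (-a)..t, κ⁻¹ * (V τ * cexp (w * τ)) := by
            simp only [hFdef]
            refine intervalIntegral.integral_congr_ae ?_
            filter_upwards [hVu] with τ hτ _
            rw [hτ]; field_simp
        _ = κ⁻¹ * ∫ τ in (-a)..t, V τ * cexp (w * τ) := intervalIntegral.integral_const_mul _ _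
        _ = κ⁻¹ * ∫ τ in (-a)..t, F τ := by
            congr 1
            refine intervalIntegral.integral_congr fun τ hτ ↦ ?_
            rw [uIcc_of_le hat] at hτ
            have hτ' : τ ∈ Icc (-a) a := ⟨hτ.1, hτ.2.trans ht.2⟩
            simp only [hVdef, indicator_of_mem hτ', hGdef]
            rw [mul_assoc, mul_comm (F τ), ← mul_assoc, ← Complex.exp_add, neg_add_cancel,
              Complex.exp_zero, one_mul]
  -- hence `F ≡ 0` on `ℝ`
  have hF_all : ∀ t, F t = 0 := by
    intro t
    rcases lt_trichotomy t (-a) with ht | rfl | ht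
    · simp only [hFdef]
      rw [intervalIntegral.integral_symm, neg_eq_zero]
      apply intervalIntegral.integral_zero_ae
      filter_upwards [hu_off] with τ hτ hτm
      rw [uIoc_of_le ht.le] at hτm
      rw [hτ fun h ↦ by linarith [hτm.2, h.1], zero_mul]
    · exact hF_zero _ ⟨le_rfl, by linarith⟩
    · rcases le_or_gt t a with hta | hta
      · exact hF_zero t ⟨ht.le, hta⟩
      · have hsplit : F t = F a + ∫ τ in a..t, u τ * cexp (w * τ) := by
          simp only [hFdef]
          rw [intervalIntegral.integral_add_adjacent_intervals
            (hu.integrable_mul_cexp w).intervalIntegrable (hu.integrable_mul_cexp w).intervalIntegrable]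
        rw [hsplit, hF_zero a ⟨by linarith, le_rfl⟩, zero_add]
        apply intervalIntegral.integral_zero_ae
        filter_upwards [hu_off] with τ hτ hτm
        rw [uIoc_of_le hta.le] at hτm
        rw [hτ fun h ↦ by linarith [hτm.1, h.2], zero_mul]
  -- all interval integrals of `u e^{wτ}` vanish, so `u = 0` a.e.
  have hint_zero : ∀ s t : ℝ, s ≤ t → ∫ τ in s..t, u τ * cexp (w * τ) = 0 := by
    intro s t _
    rw [← intervalIntegral.integral_interval_sub_left (a := -a)
      (hu.integrable_mul_cexp w).intervalIntegrable (hu.integrable_mul_cexp w).intervalIntegrable]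
    change F t - F s = 0
    rw [hF_all t, hF_all s, sub_zero]
  have huE : (fun τ ↦ u τ * cexp (w * τ)) =ᵐ[volume] 0 :=
    ae_eq_zero_of_forall_intervalIntegral_eq_zero (hu.integrable_mul_cexp w) hint_zero
  have hu0 : u =ᵐ[volume] 0 := by
    filter_upwards [huE] with τ hτ
    simpa [Complex.exp_ne_zero] using hτ
  have : ∫ t, ‖u t‖ ^ 2 = 0 := by
    rw [integral_congr_ae (hu0.mono fun t ht ↦ by simp [ht] : (fun t ↦ ‖u t‖ ^ 2) =ᵐ[volume] fun _ ↦ (0 : ℝ))]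
    simp
  rw [hu1] at this
  exact one_ne_zero this

end Main

end ConnesVanSuijlekom

/-- **Discharge of `Connes2026_weilGroundState_zeros_re_eq_half`** (Connes 2026, §5–§6.1, from
Connes–van Suijlekom 2025, Thm. 6.1): if the bottom of the truncated Weil form on `[-a, a]` is
simple, isolated and even (`WeilWindowSimpleEven a`), then every zero of the transform
`û = weilMellin u` of every ground state `u` (`IsWeilGroundState a u`) lies on `Re s = 1/2`.
See the module docstring for the proof, a direct variational form of the printed one.
[cite: ConnesSuijlekom2025, Thm. 6.1] [cite: Connes2026Letter, §5 (p. 20) and §6.1] -/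
theorem Connes2026_weilGroundState_zeros_re_eq_half_holds :
    Connes2026_weilGroundState_zeros_re_eq_half := by
  intro a hW u hu s hs
  by_contra hne
  exact ConnesVanSuijlekom.weilMellin_ne_zero_of_re_ne_half hW hu hne hs

end Literature.NumberTheory.LFunctions
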